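import Literature.Geometry.Lorentzian.StaticBlackHoleUniqueness
import Literature.Geometry.Lorentzian.CausalityPushUp
import Literature.Geometry.Lorentzian.MinkowskiGlobalHyperbolicity
import Literature.Geometry.Lorentzian.ExtensionProofs
import Literature.Geometry.Lorentzian.HypersurfaceRestriction
import Literature.Geometry.Lorentzian.SecondFundamentalFormApply
import Literature.Geometry.Lorentzian.CoordinateFrames
import Literature.Geometry.Lorentzian.TracedGaussEquationGeneral
import Literature.Geometry.Lorentzian.MetricValCongr
import Literature.Geometry.Lorentzian.IsometryProofs
import Literature.Geometry.Lorentzian.ConformalChange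
import Literature.Geometry.Lorentzian.DalembertianCompose
import HarnessLib

-- 2026-08-15 (same provefact seat, v2): + causal convexity of the d.o.c. (`mem_docOfEnd_of_mem_causalFuture_of_mem_causalPast`,
-- `causalFuture_inter_causalPast_subset_docOfEnd`, `causalFuture_inter_causalPast_subset_doc`,
-- `IsSliceRegular.isCompact_causalDiamond_and_subset_doc`, `IsSliceRegular.isCausallyWellBehaved`); v1 (p53689) unchanged.
-- v3: + `horizon_eq_empty_of_isIsometry_minkowski` (universe 0): a non-empty horizon excludes a d.o.c. isometric to Minkowski
-- space-time, via Sbierski's `minkowski_isC0Inextendible_holds` (ExtensionProofs); v1/v2 (p53689/p54103) unchanged.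
-- v4: + pointwise Vishveshwara identities for hypersurface-orthogonal Killing fields (`IsKillingField.val_leviCivita_antisymm`,
-- `IsKillingField.twistForm_eq`, `IsHypersurfaceOrthogonalOn.killing_contract`, `….killing_wedge_eq_of_null`,
-- `….val_leviCivita_self_eq_zero_of_null`, `IsStatic.killing_contract`); v1–v3 (p53689/p54103/p54713) unchanged.
-- v5: + pointwise surface gravity on the null set (`exists_val_ne_zero_of_ne_zero`, `IsKillingField.val_leviCivita_self_left`,
-- `IsHypersurfaceOrthogonalOn.exists_leviCivita_self_eq_smul_of_null`, `IsStatic.exists_leviCivita_killing_self_eq_smul`); v1–v4 unchanged.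
-- v6: + the orthogonal distribution of a hypersurface-orthogonal Killing field is totally geodesic where `X ≠ 0`
-- (`IsHypersurfaceOrthogonalOn.val_leviCivita_eq_zero_of_orthogonal`, `IsStatic.val_leviCivita_killing_eq_zero_of_orthogonal`); v1–v5 unchanged.
-- v6 also: connectedness of `M_ext` and of the d.o.c. (`E3.isPathConnected_normGt`, `AFEnd.isPreconnected_far'`,
-- `isPreconnected_image_far`, `isConnected_Mext`, `LorentzianMetric.IsFutureTimelikeCurveOn.mem_causalDiamond`,
-- `LorentzianMetric.isPreconnected_docOfEnd`, `isConnected_doc`); `M_ext ⊆ ⟨⟨M_ext⟩⟩`, `⟨⟨M_ext⟩⟩ ≠ ∅` are taken from the sibling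
-- `StationaryBlackHoleUniquenessProofs.lean` (p57310, landed while this was in flight) as private copies (no import: that file
-- cites this one and may import it). v1–v5 unchanged.
-- v7: + static slices orthogonal to the Killing field are totally geodesic (`IsHypersurfaceOrthogonalOn.isTotallyGeodesic_of_orthogonal`,
-- `IsStatic.isTotallyGeodesic_embed_of_orthogonal`; imports SecondFundamentalFormApply, CoordinateFrames); v1–v6 unchanged.
-- v8: + time-symmetric data for the unit normal (`val_normalDerivAlong_smul_restrict`, `….isTotallyGeodesic_of_killing_eq_smul`,
-- `IsStatic.isTotallyGeodesic_embed_normal`, `IsStatic.k_eq_zero_of_killing_eq_smul_normal`); v1–v7 unchanged.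
-- v9: + scalar-flatness of the static slice via the traced Gauss equation (`isSpacelikeImmersion_embed`, `inducedMetric_embed_val_eq`,
-- `IsStatic.scalarCurvature_slice_eq_zero`, `IsStatic.isTimeSymmetric_and_isVacuumConstraintSolution`; imports TracedGaussEquationGeneral,
-- MetricValCongr, IsometryProofs); v1–v8 unchanged.
-- v10: + Bunting–Masood-ul-Alam's rescalings ((1 ± V)/2)⁴ h are scalar-flat (`PseudoRiemannianMetric.dalembertian_bmaFactor`,
-- `….scalarCurvature_bmaConformal_eq_zero`, `IsStatic.scalarCurvature_bmaConformal_slice_eq_zero`; imports ConformalChange, DalembertianCompose).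
-- dedup (dedup-00868/00867): the private restatements `one_le_infty`/`two_le_infty` of Mathlib's `ENat.LEInfty.out` are
-- deleted and their three uses take `ENat.LEInfty.out` directly; no statement changed.
/-!
# Static black-hole uniqueness (Chruściel–Galloway 2010): proved glue lemmas

Companion (proofs-only) file of `Literature.Geometry.Lorentzian.StaticBlackHoleUniqueness`, which
records the static classification theorem (Chruściel–Costa–Heusler, *Living Rev. Relativity* 15
(2012) 7 = arXiv:1205.6112, Thm. 3.1; analyticity removed by Chruściel–Galloway, *Class. Quantum
Grav.* 27 (2010) 152001 = arXiv:1004.0513, Thm. 1.1 / Thm. 4.1) as the named fact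
`ChruscielGalloway2010_staticUniqueness` (D-0014).

## Status of the named fact (provefact seat, 2026-08-15)

The statement was audited clause by clause against the printed Theorem 3.1 (asymptotic flatness
`O₂(r^{-α})`/`O₁(r^{-1-α})` = CCH 2012 §2.1 with `k = 2 > 1`; stationarity = §2.3; d.o.c. and
`𝓔⁺` = §2.4; staticity `X ∧ dX = 0` on `M` = §3.1; a closed, acausal, one-ended embedded slice is a
hypersurface `S = S̄` with empty boundary, `∂S̄ = ∅ ⊆ M ∖ ⟨⟨M_ext⟩⟩`; global hyperbolicity of `M`
gives that of the causally convex d.o.c.) and found to be a faithful special case (vacuum, one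
end) — not mis-stated. Its printed proof is a theory (smoothness of horizons and the structure
theorem of the d.o.c., Chruściel–Costa 2008; the Vishveshwara–Carter lemma; the no-prehorizon
Theorem 1.1 of Chruściel–Galloway 2010 with the inner trapped spheres of Chruściel–Galloway–Solis
2009; non-existence of degenerate components, Chruściel–Reall–Tod 2006; Chruściel 1999 with the
Bunting–Masood-ul-Alam conformal doubling and the rigidity case of the positive energy theorem),
none of which exists in Mathlib or in `Literature/` — the fact stays a named fact.

## What is proved here

The set-theoretic half of the remark, in the module docstring of the statement file (*The
asserted instance*), by which the hypothesis `𝓑.horizon.Nonempty` forces a positive mass in the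
conclusion: a non-empty future event horizon `𝓔⁺ = ∂⟨⟨M_ext⟩⟩ ∩ I⁺(M_ext)` (Chruściel–Costa–Heusler
2012, §2.4) lies in `closure ⟨⟨M_ext⟩⟩ ∖ ⟨⟨M_ext⟩⟩`, so the (open) d.o.c. is neither all of `M` nor
closed in `M` — the connected space-time `M` is a proper extension of `⟨⟨M_ext⟩⟩` (whereas
Minkowski space-time, the d.o.c. of the massless Schwarzschild member, is inextendible).

* `StationaryAFBlackHole.horizon_subset_frontier_doc` — `𝓔⁺ ⊆ ∂⟨⟨M_ext⟩⟩`;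
* `StationaryAFBlackHole.horizon_subset_closure_doc` — `𝓔⁺ ⊆ closure ⟨⟨M_ext⟩⟩`;
* `StationaryAFBlackHole.doc_ne_univ_of_horizon_nonempty` — `𝓔⁺ ≠ ∅ → ⟨⟨M_ext⟩⟩ ≠ M`;
* `StationaryAFBlackHole.not_isClosed_doc_of_horizon_nonempty` — `𝓔⁺ ≠ ∅ → ⟨⟨M_ext⟩⟩` not closed;
* `StationaryAFBlackHole.exists_mem_closure_doc_not_mem` — packaged form.

Openness of `I^±(M_ext)` enters, as everywhere in `Stationary.lean`, through the hypotheses `hF`,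
`hP` (parametrised predicates `isOpen_chronologicalFuture/Past` of `Causality.lean`).

And the causal half of the derivation, in the same docstring, of the printed hypothesis "the
domain of outer communication `⟨⟨M_ext⟩⟩` is globally hyperbolic" from clause (iv) of
`IsSliceRegular` (`M` globally hyperbolic): the d.o.c. `I⁺(M_ext) ∩ I⁻(M_ext)` is **causally
convex** — by push-up `p ≤ q ≪ r ⟹ p ≪ r` and its time dual (O'Neill 1983, Ch. 14, Cor. 14.1;
proved on manifolds without boundary in `Literature.Geometry.Lorentzian.CausalityPushUp`) a causal
curve between two points of the d.o.c. never leaves it — so the causal diamonds of its points,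
computed in `M`, lie in the d.o.c. and are compact when `M` is globally hyperbolic (Bernal–Sánchez
form `IsGloballyHyperbolic` of `Causality.lean`).

* `LorentzianMetric.mem_docOfEnd_of_mem_causalFuture_of_mem_causalPast` — causal convexity of
  `⟨⟨M_ext⟩⟩ = I⁺(M_ext) ∩ I⁻(M_ext)` on any manifold without boundary (`Cⁿ` metric, `n ≥ 1`);
* `LorentzianMetric.causalFuture_inter_causalPast_subset_docOfEnd` — diamond form;
* `StationaryAFBlackHole.causalFuture_inter_causalPast_subset_doc` — for the hypothesis structure;
* `StationaryAFBlackHole.IsSliceRegular.isCompact_causalDiamond_and_subset_doc` — under slice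
  regularity every causal diamond of two points of `⟨⟨M_ext⟩⟩` is a compact subset of `⟨⟨M_ext⟩⟩`.

(The identification of the intrinsic causal relations of the open sub-space-time `⟨⟨M_ext⟩⟩` with
the ambient ones restricted to it — immediate for a causally convex open set — is not spelled out:
the prelude states global hyperbolicity for a metric on a whole manifold only.)

## Static slices are totally geodesic (v7)

With the tree's hypersurface calculus (`secondFundamentalForm`, `normalDerivAlong`,
`secondFundamentalForm_apply_holds`, `covariantDerivAlong_comp_holds`) the pointwise identity of v6
integrates to the classical statement behind the Riemannian reformulation of the static problem:
**a hypersurface everywhere orthogonal to a hypersurface-orthogonal Killing field `X ≠ 0` is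
totally geodesic** with respect to the normal field `X ∘ f`
(`IsHypersurfaceOrthogonalOn.isTotallyGeodesic_of_orthogonal`,
`StationaryAFBlackHole.IsStatic.isTotallyGeodesic_embed_of_orthogonal`): `K_{X∘f}(v, w) =
g(D_v (X ∘ f), df w) = g(∇_{df v} X, df w) = 0`. The static slices thus carry time-symmetric data
`K = 0`, and the vacuum constraints reduce to `R(γ) = 0` with the lapse equation — the data
`(S, γ, V)` of Israel's and Bunting–Masood-ul-Alam's arguments (Chruściel–Costa–Heusler 2012,
§3.1); those arguments themselves remain out of reach. In terms of the **unit** normal `n` and the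
lapse (v8): if `X ∘ embed = V • n` with `V` nowhere zero and differentiable, the Leibniz rule along
the chart-straight curves (`covariantDerivAlong_smul_holds`) gives `K_{V⁻¹ (X∘f)} = V⁻¹ K_{X∘f}` on
basis vectors (`val_normalDerivAlong_smul_restrict`), whence `K_n = 0`
(`IsHypersurfaceOrthogonalOn.isTotallyGeodesic_of_killing_eq_smul`,
`StationaryAFBlackHole.IsStatic.isTotallyGeodesic_embed_normal`) and, through the structure field
`induced_k`, `k = 0` for the initial data set of the slice
(`StationaryAFBlackHole.IsStatic.k_eq_zero_of_killing_eq_smul_normal`).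

## The static slice is scalar-flat (v9)

Finally the vacuum equations enter: by the twice-traced Gauss equation of the tree
(`PseudoRiemannianMetric.scalarCurvature_inducedMetric_eq_general`, O'Neill 1983, Ch. 4, Thm. 5
and Corollary; timelike unit normal, `ε = -1`) `R(h) = R(g) + 2 Ric(n, n) + |K|² - H²` for the
induced metric `h = embed^* g` of the slice; with `Ric(g) = 0` and `K = 0` this gives **`R(h) = 0`**
(`StationaryAFBlackHole.IsStatic.scalarCurvature_slice_eq_zero`, after identifying the induced
metric with the data metric through `induced_h`, `MetricValCongr`), and hence the static slice
carries **time-symmetric data solving the vacuum constraints**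
(`StationaryAFBlackHole.IsStatic.isTimeSymmetric_and_isVacuumConstraintSolution`, through
`InitialDataSet.isVacuumConstraintSolution_iff_of_isTimeSymmetric`). This is the Riemannian
manifold `(S, h)`, `R(h) = 0`, with the lapse `V`, on which Bunting–Masood-ul-Alam perform the
conformal rescalings `h± = ((1 ± V)/2)⁴ h` and apply the positive energy theorem
(Chruściel–Costa–Heusler 2012, §3.1); the smoothness of the unit normal as a map into `TM`, not a
field of the hypothesis structure, is assumed.

## Bunting–Masood-ul-Alam's conformal rescalings (v10)

One step into Bunting–Masood-ul-Alam's argument itself: with the conformal transformation law of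
scalar curvature in dimension three (`scalarCurvature_conformal_fourth_power`,
`R(φ⁴ γ) = φ⁻⁵ (R(γ) φ − 8 Δ_γ φ)`, Schoen–Yau 1979, p. 49, proved in `ConformalChange.lean`) and
the chain rule for the Laplace–Beltrami operator (`dalembertian_real_comp`), a scalar-flat
Riemannian `3`-manifold `(Y, γ)` with a smooth `γ`-harmonic `V`, `1 ± V > 0`, has **scalar-flat
rescalings `γ± = ((1 ± V)/2)⁴ γ`** (`PseudoRiemannianMetric.scalarCurvature_bmaConformal_eq_zero`,
specialised to the static slice in `StationaryAFBlackHole.IsStatic.scalarCurvature_bmaConformal_slice_eq_zero`,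
where the lapse equation `Δ_h V = 0` is a hypothesis). What Bunting–Masood-ul-Alam then do — glue
`(S, γ₊)` and `(S, γ₋)` along the totally geodesic boundary `{V = 0}`, check completeness,
asymptotic flatness with vanishing mass of the `γ₊` end and one-point compactifiability of the `γ₋`
end, and invoke the rigidity case of the positive energy theorem to get flatness, whence
`γ = V⁻⁴ δ`-type formulae and Schwarzschild — is not formalised (the tree states the positive
energy theorem and its rigidity case as the unproved named facts
`positive_mass_theorem_riemannian`, `positive_mass_rigidity` of `MassInequalities.lean`).

## The d.o.c. is connected (v6)

**`M_ext` and `⟨⟨M_ext⟩⟩` are connected** (`StationaryAFBlackHole.isConnected_Mext`,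
`StationaryAFBlackHole.isConnected_doc`; generic form `LorentzianMetric.isPreconnected_docOfEnd`):
`M_ext` is the union of the Killing orbits (connected) through the connected embedded far region
(image of the exterior of a ball in `ℝ³`, `E3.isPathConnected_normGt`, `AFEnd.isPreconnected_far'`),
and every `p ∈ ⟨⟨M_ext⟩⟩` hangs on `M_ext` by a timelike segment whose points lie in
`J⁺(m) ∩ J⁻(p) ⊆ ⟨⟨M_ext⟩⟩` (`LorentzianMetric.IsFutureTimelikeCurveOn.mem_causalDiamond` and causal
convexity). So the conclusion "isometric to *the* d.o.c. of a Schwarzschild space-time" compares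
connected open sub-space-times, as it should (Chruściel–Costa–Heusler 2012, §2.4). The inputs
`M_ext ⊆ ⟨⟨M_ext⟩⟩` and `Σ_ext ≠ ∅` are the theorems `StationaryAFBlackHole.Mext_subset_doc`,
`StationaryAFBlackHole.image_far_nonempty` of the sibling
`Literature.Geometry.Lorentzian.StationaryBlackHoleUniquenessProofs`; they are re-derived here as
private helpers rather than imported, so that that file (which refers to the causal-convexity
lemmas above) remains free to import this one.

## The massless member is excluded (v3)

Finally the analytic half of the first remark: **if the future event horizon is non-empty, the
d.o.c. is not isometric to Minkowski space-time**
(`StationaryAFBlackHole.horizon_eq_empty_of_isIsometry_minkowski`, contrapositive form). Given a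
diffeomorphism `Φ : ⟨⟨M_ext⟩⟩ ≅ ℝ⁴` pulling `η` back to `g|_{⟨⟨M_ext⟩⟩}`, the map
`ι = incl ∘ Φ⁻¹ : ℝ⁴ → M` is a smooth isometric open embedding with image `⟨⟨M_ext⟩⟩ ≠ M`, i.e. a
`C^∞`- (a fortiori `C⁰`-) extension of Minkowski space-time in the sense of Sbierski 2018,
Def. 2.1 (`LorentzianManifold.IsExtension`, `Literature.Geometry.Lorentzian.Extension`),
contradicting Sbierski's theorem (J. Differential Geom. 108 (2018), Thm. 1 (i)), *proved* in the
tree as `minkowski_isC0Inextendible_holds` (`Literature.Geometry.Lorentzian.ExtensionProofs`).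
This is why the conclusion `IsIsometricToSchwarzschildExterior` of the named fact can demand a
positive mass. The lemma is stated for space-times in universe `0` (the universe of
`Minkowski.spacetime`, in which `LorentzianManifold.IsExtendible` quantifies its extensions).

## First step of the theorem proper: Vishveshwara's identity (v4)

The removal of analyticity concerns null orbits of the static Killing vector `X` inside the
d.o.c.; the first step (Chruściel–Costa–Heusler 2012, §3.1: "the Vishveshwara–Carter lemma …
shows that null orbits of static Killing vectors form a prehorizon"; §2.5, Vishveshwara [CVV68])
rests on a pointwise identity which the tree's vocabulary (`twistForm`, `leviCivita`,
`IsKillingField`) can express and which is proved here: for a Killing field the twist form is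
`(X♭ ∧ dX♭)(u, v, w) = 2 Σ_cyclic X♭(u) g(∇_v X, w)` (`IsKillingField.twistForm_eq`), and
contracting `X♭ ∧ dX♭ = 0` with `X` gives
`X♭(u) g(∇_v X, X) − X♭(v) g(∇_u X, X) + g(X, X) g(∇_u X, v) = 0`
(`IsHypersurfaceOrthogonalOn.killing_contract`, `StationaryAFBlackHole.IsStatic.killing_contract`);
on the null set `{g(X, X) = 0}` the one-form `v ↦ g(∇_v X, X)` (`= ½ d(g(X, X))` by metric
compatibility) is therefore proportional to `X♭` (`….killing_wedge_eq_of_null`,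
`….val_leviCivita_self_eq_zero_of_null`) — the null set is ruled by null hypersurfaces normal
(and tangent) to `X`, i.e. by Killing prehorizons. As a consequence (v5), wherever a
static Killing vector is null and non-zero it is pre-geodesic, `∇_X X = κ X`
(`IsHypersurfaceOrthogonalOn.exists_leviCivita_self_eq_smul_of_null`,
`StationaryAFBlackHole.IsStatic.exists_leviCivita_killing_self_eq_smul`): the pointwise surface
gravity of Chruściel–Costa–Heusler 2012, §2.5.3 (`∇_k k = κ k` on `H[k]`), which the tree's
`LorentzianMetric.IsNonDegenerateHorizon` postulates with `κ ≠ 0`. Moreover (v6) the same identity gives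
the "totally geodesic" clause of the Vishveshwara–Carter lemma pointwise and everywhere off the
zero set: `g(∇_u X, w) = 0` for all `u, w ⊥ X` wherever `X ≠ 0`
(`IsHypersurfaceOrthogonalOn.val_leviCivita_eq_zero_of_orthogonal`) — the leaves of `X^⊥`
(the static slices where `X` is timelike, the prehorizon leaves where it is null) have vanishing
second fundamental form (Chruściel–Costa–Heusler 2012, §2.5.2: "the set `{g(k,k) = 0, k ≠ 0}` is
the union of integral leaves of the distribution `k^⊥`, which are totally geodesic within
`M ∖ {k = 0}`"). Everything after these
identities (that the null leaves are embedded hypersurfaces forming prehorizons which cannot meet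
an `I⁺`-regular d.o.c., Chruściel–Galloway 2010, Thm. 1.1; constancy and non-vanishing of `κ`,
Chruściel–Reall–Tod 2006) is out of reach of the present vocabulary.

## References

* P. T. Chruściel, J. L. Costa, M. Heusler, *Stationary black holes: uniqueness and beyond*,
  Living Rev. Relativity 15 (2012) 7, arXiv:1205.6112, §2.4 and Theorem 3.1
  (key `ChruscielCostaHeusler2012`).
* P. T. Chruściel, G. J. Galloway, *Uniqueness of static black holes without analyticity*,
  Class. Quantum Grav. 27 (2010) 152001, arXiv:1004.0513 (key `ChruscielGalloway2010`).
* B. O'Neill, *Semi-Riemannian geometry*, Academic Press 1983, Ch. 14, Cor. 14.1, p. 403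
  (key `ONeillSemiRiemannian1983`).
* J. Sbierski, *The `C⁰`-inextendibility of the Schwarzschild spacetime and the spacelike diameter
  in Lorentzian geometry*, J. Differential Geom. 108 (2018) 319–378, Def. 2.1, Thm. 1
  (key `SbierskiJDG2018`).
* G. J. Galloway, E. Ling, J. Sbierski, *Timelike completeness as an obstruction to
  `C⁰`-extensions*, Commun. Math. Phys. 359 (2018) 937–949, Thm. 1.2
  (key `GallowayLingSbierski2017`).
* R. M. Wald, *General Relativity*, Chicago 1984, §7.1, (7.1.1) and App. B.3 (key `Wald1984`).
* B. O'Neill, *Semi-Riemannian geometry*, Ch. 9, Prop. 9.25 (Killing equation).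
-/

noncomputable section

open Set TopologicalSpace Bundle Topology
open scoped ContDiff Manifold

universe u

namespace Literature.Geometry.Lorentzian

namespace StationaryAFBlackHole

variable (𝓑 : StationaryAFBlackHole.{u})

/-- **The future event horizon lies in the frontier of the domain of outer communications**,
`𝓔⁺ ⊆ ∂⟨⟨M_ext⟩⟩` (given openness of `I^±(M_ext)`, hypotheses `hF`, `hP`): immediate from
`𝓔⁺ = ∂⟨⟨M_ext⟩⟩ ∩ I⁺(M_ext)` (`futureEventHorizonOfEnd_eq_frontier_docOfEnd_inter`).
Chruściel–Costa–Heusler 2012, §2.4 ("the boundaries of `⟨⟨M_ext⟩⟩` are included in the event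
horizons. We set `𝓔^± = ∂⟨⟨M_ext⟩⟩ ∩ I^±(M_ext)`"). [cite: ChruscielCostaHeusler2012, §2.4] -/
theorem horizon_subset_frontier_doc
    (hF : 𝓑.metric.isOpen_chronologicalFuture 𝓑.timeOrientation)
    (hP : 𝓑.metric.isOpen_chronologicalPast 𝓑.timeOrientation) :
    𝓑.horizon ⊆ frontier 𝓑.doc := by
  intro x hx
  have hx' : x ∈ 𝓑.metric.futureEventHorizonOfEnd 𝓑.timeOrientation 𝓑.Mext := hx
  rw [𝓑.metric.futureEventHorizonOfEnd_eq_frontier_docOfEnd_inter (τ := 𝓑.timeOrientation) hF hP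
    ENat.LEInfty.out 𝓑.Mext] at hx'
  exact hx'.1

/-- The future event horizon lies in the closure of the domain of outer communications,
`𝓔⁺ ⊆ closure ⟨⟨M_ext⟩⟩` (hypotheses `hF`, `hP`). Chruściel–Costa–Heusler 2012, §2.4. [cite: ChruscielCostaHeusler2012, §2.4] -/
theorem horizon_subset_closure_doc
    (hF : 𝓑.metric.isOpen_chronologicalFuture 𝓑.timeOrientation)
    (hP : 𝓑.metric.isOpen_chronologicalPast 𝓑.timeOrientation) :
    𝓑.horizon ⊆ closure 𝓑.doc :=
  (𝓑.horizon_subset_frontier_doc hF hP).trans frontier_subset_closure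

/-- **A black hole is not its own domain of outer communications**: if the future event horizon
is non-empty, then `⟨⟨M_ext⟩⟩ ≠ M` (`𝓔⁺` is disjoint from the d.o.c., hypothesis `hP`). First half
of the remark, in the module docstring of the statement file, that `𝓑.horizon.Nonempty` excludes
the Minkowskian (massless) member from the conclusion of the static classification theorem.
Chruściel–Costa–Heusler 2012, §2.4. [cite: ChruscielCostaHeusler2012, §2.4] -/
theorem doc_ne_univ_of_horizon_nonempty
    (hP : 𝓑.metric.isOpen_chronologicalPast 𝓑.timeOrientation) (h : 𝓑.horizon.Nonempty) :
    𝓑.doc ≠ univ := by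
  obtain ⟨x, hx⟩ := h
  intro huniv
  have hxdoc : x ∈ 𝓑.doc := by
    rw [huniv]
    exact mem_univ x
  exact Set.disjoint_left.1 (𝓑.disjoint_horizon_doc hP) hx hxdoc

/-- **A non-empty horizon makes the d.o.c. a non-closed (open) subset of `M`**: any point of `𝓔⁺`
lies in `closure ⟨⟨M_ext⟩⟩ ∖ ⟨⟨M_ext⟩⟩`; in particular the connected space-time `M` is a proper
extension of the open sub-space-time `⟨⟨M_ext⟩⟩` (second half of the same remark; hypotheses
`hF`, `hP`). Chruściel–Costa–Heusler 2012, §2.4. [cite: ChruscielCostaHeusler2012, §2.4] -/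
theorem not_isClosed_doc_of_horizon_nonempty
    (hF : 𝓑.metric.isOpen_chronologicalFuture 𝓑.timeOrientation)
    (hP : 𝓑.metric.isOpen_chronologicalPast 𝓑.timeOrientation) (h : 𝓑.horizon.Nonempty) :
    ¬ IsClosed 𝓑.doc := by
  obtain ⟨x, hx⟩ := h
  intro hcl
  have hxcl : x ∈ closure 𝓑.doc := 𝓑.horizon_subset_closure_doc hF hP hx
  rw [hcl.closure_eq] at hxcl
  exact Set.disjoint_left.1 (𝓑.disjoint_horizon_doc hP) hx hxcl

/-- Under `𝓑.horizon.Nonempty` there is a point of `M` outside `⟨⟨M_ext⟩⟩` but in its closure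
(any point of `𝓔⁺`): packaged form of the two previous lemmas, as used in the statement file's
module docstring to force `M > 0`. Chruściel–Costa–Heusler 2012, §2.4. [cite: ChruscielCostaHeusler2012, §2.4] -/
theorem exists_mem_closure_doc_not_mem
    (hF : 𝓑.metric.isOpen_chronologicalFuture 𝓑.timeOrientation)
    (hP : 𝓑.metric.isOpen_chronologicalPast 𝓑.timeOrientation) (h : 𝓑.horizon.Nonempty) :
    ∃ x : 𝓑.carrier, x ∈ closure 𝓑.doc ∧ x ∉ 𝓑.doc := by
  obtain ⟨x, hx⟩ := h
  exact ⟨x, 𝓑.horizon_subset_closure_doc hF hP hx,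
    fun hxdoc ↦ Set.disjoint_left.1 (𝓑.disjoint_horizon_doc hP) hx hxdoc⟩

end StationaryAFBlackHole

/-! ### Causal convexity of the domain of outer communications -/

namespace LorentzianMetric

variable {E : Type*} [NormedAddCommGroup E] [NormedSpace ℝ E] {H : Type*} [TopologicalSpace H]
  {I : ModelWithCorners ℝ E H} {n : ℕ∞ω} {M : Type*} [TopologicalSpace M] [ChartedSpace H M]
  [IsManifold I ∞ M] {g : LorentzianMetric I n M} {τ : TimeOrientation g}

/-- **The domain of outer communications is causally convex.** On a manifold without boundary
(finite dimension, `Cⁿ` metric with `1 ≤ n`), if `p, q ∈ ⟨⟨M_ext⟩⟩ = I⁺(M_ext) ∩ I⁻(M_ext)` and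
`p ≤ x ≤ q`, then `x ∈ ⟨⟨M_ext⟩⟩`: from `m ≪ p ≤ x` push-up (time dual of O'Neill's Cor. 14.1) gives
`m ≪ x`, and from `x ≤ q ≪ m'` it gives `x ≪ m'`. This is the reason why global hyperbolicity of
`M` passes to the d.o.c. (Chruściel–Costa–Heusler 2012, Thm. 3.1 asks for the latter). O'Neill
1983, Ch. 14, Cor. 14.1 and p. 403 (`I⁺(A) = I⁺(J⁺A) = J⁺(I⁺A)`); Chruściel–Costa–Heusler 2012,
§2.4. [cite: ONeillSemiRiemannian1983, Ch. 14, Cor. 14.1 and p. 403] -/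
theorem mem_docOfEnd_of_mem_causalFuture_of_mem_causalPast [FiniteDimensional ℝ E]
    [BoundarylessManifold I M] (hn : 1 ≤ n) {Mext : Set M} {p q x : M}
    (hp : p ∈ g.docOfEnd τ Mext) (hq : q ∈ g.docOfEnd τ Mext)
    (hxp : x ∈ g.causalFuture τ {p}) (hxq : x ∈ g.causalPast τ {q}) :
    x ∈ g.docOfEnd τ Mext := by
  refine ⟨?_, ?_⟩
  · -- `m ≪ p ≤ x ⟹ m ≪ x`, by push-up for the reversed time orientation
    obtain ⟨m, hm, γ, a, b, hab, hγ, hγa, hγb⟩ := hp.1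
    have hpm : p ∈ g.chronologicalFuture τ {m} := ⟨m, rfl, γ, a, b, hab, hγ, hγa, hγb⟩
    have h1 : p ∈ g.causalFuture τ.reverse {x} := mem_causalPast_of_mem_causalFuture hxp
    have h2 : m ∈ g.chronologicalFuture τ.reverse {p} :=
      mem_chronologicalPast_of_mem_chronologicalFuture hpm
    have h3 : m ∈ g.chronologicalFuture τ.reverse {x} :=
      mem_chronologicalFuture_of_mem_causalFuture hn h1 h2
    have h4 : x ∈ g.chronologicalFuture τ {m} :=
      mem_chronologicalFuture_of_mem_chronologicalPast h3
    exact chronologicalFuture_mono (singleton_subset_iff.mpr hm) h4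
  · -- `x ≤ q ≪ m' ⟹ x ≪ m'`, by push-up
    obtain ⟨m', hm', γ, a, b, hab, hγ, hγa, hγb⟩ := hq.2
    have hqm : q ∈ g.chronologicalPast τ {m'} := ⟨m', rfl, γ, a, b, hab, hγ, hγa, hγb⟩
    have h1 : q ∈ g.causalFuture τ {x} := mem_causalPast_singleton_iff.mp hxq
    have h2 : m' ∈ g.chronologicalFuture τ {q} :=
      mem_chronologicalFuture_of_mem_chronologicalPast hqm
    have h3 : m' ∈ g.chronologicalFuture τ {x} := mem_chronologicalFuture_of_mem_causalFuture hn h1 h2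
    have h4 : x ∈ g.chronologicalPast τ {m'} := mem_chronologicalPast_of_mem_chronologicalFuture h3
    exact chronologicalFuture_mono (g := g) (τ := τ.reverse) (singleton_subset_iff.mpr hm') h4

/-- **Causal diamonds of the d.o.c. stay in the d.o.c.** (diamond form of causal convexity): for
`p, q ∈ ⟨⟨M_ext⟩⟩`, `J⁺(p) ∩ J⁻(q) ⊆ ⟨⟨M_ext⟩⟩` (manifold without boundary, `1 ≤ n`). O'Neill
1983, Ch. 14, Cor. 14.1; Chruściel–Costa–Heusler 2012, §2.4. [cite: ONeillSemiRiemannian1983, Ch. 14, Cor. 14.1] -/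
theorem causalFuture_inter_causalPast_subset_docOfEnd [FiniteDimensional ℝ E]
    [BoundarylessManifold I M] (hn : 1 ≤ n) {Mext : Set M} {p q : M}
    (hp : p ∈ g.docOfEnd τ Mext) (hq : q ∈ g.docOfEnd τ Mext) :
    g.causalFuture τ {p} ∩ g.causalPast τ {q} ⊆ g.docOfEnd τ Mext :=
  fun _ hx ↦ mem_docOfEnd_of_mem_causalFuture_of_mem_causalPast hn hp hq hx.1 hx.2

end LorentzianMetric

namespace StationaryAFBlackHole

variable (𝓑 : StationaryAFBlackHole.{u})

/-- **The domain of outer communications of a stationary asymptotically flat black hole is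
causally convex**: causal diamonds `J⁺(p) ∩ J⁻(q)` of points `p, q ∈ ⟨⟨M_ext⟩⟩`, computed in the
space-time `M` (a `4`-manifold without boundary), lie in `⟨⟨M_ext⟩⟩`. O'Neill 1983, Ch. 14,
Cor. 14.1; Chruściel–Costa–Heusler 2012, §2.4. [cite: ONeillSemiRiemannian1983, Ch. 14, Cor. 14.1] -/
theorem causalFuture_inter_causalPast_subset_doc {p q : 𝓑.carrier} (hp : p ∈ 𝓑.doc)
    (hq : q ∈ 𝓑.doc) :
    𝓑.metric.causalFuture 𝓑.timeOrientation {p} ∩ 𝓑.metric.causalPast 𝓑.timeOrientation {q} ⊆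
      𝓑.doc :=
  LorentzianMetric.causalFuture_inter_causalPast_subset_docOfEnd (g := 𝓑.metric)
    (τ := 𝓑.timeOrientation) ENat.LEInfty.out hp hq

variable {𝓑} in
/-- **Slice regularity gives the global-hyperbolicity hypothesis of Theorem 3.1 on the d.o.c.**
(in ambient form): if `𝓑` is slice-regular (clause (iv): `M` globally hyperbolic in the
Bernal–Sánchez form — causal, with compact causal diamonds), then for all `p, q ∈ ⟨⟨M_ext⟩⟩` the
causal diamond `J⁺(p) ∩ J⁻(q)` is compact **and contained in `⟨⟨M_ext⟩⟩`** (causal convexity), which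
is what makes the open sub-space-time `⟨⟨M_ext⟩⟩` globally hyperbolic in its own right; causality of
`M` is inherited trivially. Chruściel–Costa–Heusler 2012, Thm. 3.1 (hypothesis "`⟨⟨M_ext⟩⟩` is
globally hyperbolic"); Bernal–Sánchez 2007, Thm. 3.2; O'Neill 1983, Ch. 14, Cor. 14.1. [cite: ChruscielCostaHeusler2012, Thm. 3.1 (hypotheses)] -/
theorem IsSliceRegular.isCompact_causalDiamond_and_subset_doc (h : 𝓑.IsSliceRegular)
    {p q : 𝓑.carrier} (hp : p ∈ 𝓑.doc) (hq : q ∈ 𝓑.doc) :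
    IsCompact (𝓑.metric.causalFuture 𝓑.timeOrientation {p} ∩
        𝓑.metric.causalPast 𝓑.timeOrientation {q}) ∧
      𝓑.metric.causalFuture 𝓑.timeOrientation {p} ∩ 𝓑.metric.causalPast 𝓑.timeOrientation {q} ⊆
        𝓑.doc :=
  ⟨h.isGloballyHyperbolic.isCompact_causalFuture_inter_causalPast p q,
    𝓑.causalFuture_inter_causalPast_subset_doc hp hq⟩

variable {𝓑} in
/-- Under slice regularity the space-time is causal (no closed causal curves), the other clause of
the Bernal–Sánchez definition, inherited verbatim by every subset. Chruściel–Costa–Heusler 2012,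
Thm. 3.1 (hypotheses); Bernal–Sánchez 2007, Thm. 3.2. [cite: ChruscielCostaHeusler2012, Thm. 3.1 (hypotheses)] -/
theorem IsSliceRegular.isCausallyWellBehaved (h : 𝓑.IsSliceRegular) :
    𝓑.metric.IsCausallyWellBehaved 𝓑.timeOrientation :=
  h.isGloballyHyperbolic.isCausallyWellBehaved

/-! ### A non-empty horizon excludes the Minkowskian domain of outer communications -/

/-- **A black hole's domain of outer communications is not Minkowski space-time.** Let `𝓑` be a
stationary asymptotically flat black-hole space-time (universe `0`) with the standing openness
and restriction hypotheses `hF`, `hP`, `hres`, and suppose its open sub-space-time `⟨⟨M_ext⟩⟩`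
is isometric to Minkowski space-time: a `C^∞` diffeomorphism `Φ : ⟨⟨M_ext⟩⟩ ≅ ℝ⁴` with
`Φ^* η = g|_{⟨⟨M_ext⟩⟩}` (`PseudoRiemannianMetric.IsIsometry`, as in the conclusion classes
`IsIsometricToKerrExterior` / `IsIsometricToSchwarzschildExterior`). Then the future event horizon
is empty. Proof: `ι = incl ∘ Φ⁻¹ : ℝ⁴ → M` is smooth, an open embedding, isometric
(`(incl ∘ Φ⁻¹)^* g = (Φ⁻¹)^* (g|_{⟨⟨M_ext⟩⟩}) = η` by the chain rule, `d(incl) = id` and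
`dΦ ∘ dΦ⁻¹ = id`), with image `⟨⟨M_ext⟩⟩`; were `𝓔⁺ ≠ ∅`, the image would be a proper subset
(`doc_ne_univ_of_horizon_nonempty`), making `M` a `C^∞`-extension of Minkowski space-time
(Sbierski 2018, Def. 2.1), hence a `C⁰`-extension (`LorentzianManifold.isExtendible_mono`), against
Sbierski's theorem `minkowski_isC0Inextendible_holds` (J. Differential Geom. 108 (2018), Thm. 1 (i);
proved in `Literature.Geometry.Lorentzian.ExtensionProofs`). This is the step, in the module
docstring of the statement file (*The asserted instance*), by which `𝓑.horizon.Nonempty` rules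
out the massless member of the Schwarzschild family (whose d.o.c. is all of Minkowski space-time)
and lets the conclusion demand `M > 0`; there it is phrased through Galloway–Ling–Sbierski 2018,
Thm. 1.2, of which the smooth Minkowskian case used here is Sbierski's Thm. 1. [cite: SbierskiJDG2018, Thm. 1 (i) with Def. 2.1; GallowayLingSbierski2017 Thm. 1.2] -/
theorem horizon_eq_empty_of_isIsometry_minkowski (𝓑 : StationaryAFBlackHole.{0})
    (hF : 𝓑.metric.isOpen_chronologicalFuture 𝓑.timeOrientation)
    (hP : 𝓑.metric.isOpen_chronologicalPast 𝓑.timeOrientation)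
    (hres : PseudoRiemannianMetric.contMDiff_restrict (I := 𝓡 4) (n := ∞) (M := 𝓑.carrier))
    (Φ : Diffeomorph (𝓡 4) 𝓘(ℝ, E4) (𝓑.docOpens hF hP) E4 ∞)
    (hΦ : PseudoRiemannianMetric.IsIsometry
      (𝓑.metric.restrict hres (𝓑.docOpens hF hP)).toPseudoRiemannianMetric
      Minkowski.spacetime.metric.toPseudoRiemannianMetric Φ) :
    𝓑.horizon = ∅ := by
  by_contra hne
  have hne' : 𝓑.horizon.Nonempty := Set.nonempty_iff_ne_empty.mpr hne
  -- the candidate extension map `ι = incl ∘ Φ⁻¹ : ℝ⁴ → M`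
  let ι : E4 → 𝓑.carrier := Subtype.val ∘ Φ.symm
  have hsd : MDifferentiable 𝓘(ℝ, E4) (𝓡 4) Φ.symm := Φ.symm.contMDiff.mdifferentiable (by simp)
  have hd : MDifferentiable (𝓡 4) 𝓘(ℝ, E4) Φ := Φ.contMDiff.mdifferentiable (by simp)
  have h1 : ContMDiff (𝓡 4) (𝓡 4) ∞ ι := contMDiff_subtype_val.comp Φ.symm.contMDiff
  have h2 : IsOpenEmbedding ι :=
    ((𝓑.docOpens hF hP).isOpen.isOpenEmbedding_subtypeVal).comp
      Φ.symm.toHomeomorph.isOpenEmbedding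
  have h4 : Set.range ι ≠ Set.univ := by
    have hsurj : Function.Surjective (Φ.symm : E4 → 𝓑.docOpens hF hP) :=
      fun y ↦ ⟨Φ y, Φ.symm_apply_apply y⟩
    have hr : Set.range ι = (𝓑.docOpens hF hP : Set 𝓑.carrier) := by
      rw [Set.range_comp, hsurj.range_eq, Set.image_univ, Subtype.range_coe]
    rw [hr]
    exact 𝓑.doc_ne_univ_of_horizon_nonempty hP hne'
  have h3 : ∀ x : E4, pullbackBilin (I := 𝓡 4) (I' := 𝓡 4) ι 𝓑.metric.val x =
      Minkowski.spacetime.metric.val x := by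
    intro x
    have hD : mfderiv (𝓡 4) (𝓡 4) ι x = mfderiv 𝓘(ℝ, E4) (𝓡 4) Φ.symm x := by
      rw [mfderiv_comp x (hasMFDerivAt_subtypeVal (Φ.symm x)).mdifferentiableAt (hsd x),
        mfderiv_subtypeVal]
      exact ContinuousLinearMap.id_comp _
    have hcomp : (mfderiv (𝓡 4) 𝓘(ℝ, E4) Φ (Φ.symm x)).comp (mfderiv 𝓘(ℝ, E4) (𝓡 4) Φ.symm x) =
        ContinuousLinearMap.id ℝ _ := by
      rw [← mfderiv_comp x (hd _) (hsd x)]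
      have hfun : ((Φ : 𝓑.docOpens hF hP → E4) ∘ Φ.symm) = id := funext Φ.apply_symm_apply
      rw [hfun, mfderiv_id]
    have hAD : ∀ v : E4, mfderiv (𝓡 4) 𝓘(ℝ, E4) Φ (Φ.symm x)
        (mfderiv 𝓘(ℝ, E4) (𝓡 4) Φ.symm x v) = v := fun v ↦
      DFunLike.congr_fun hcomp v
    ext v w
    have key : Minkowski.bilin
        (mfderiv (𝓡 4) 𝓘(ℝ, E4) Φ (Φ.symm x) (mfderiv 𝓘(ℝ, E4) (𝓡 4) Φ.symm x v))
        (mfderiv (𝓡 4) 𝓘(ℝ, E4) Φ (Φ.symm x) (mfderiv 𝓘(ℝ, E4) (𝓡 4) Φ.symm x w)) =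
        𝓑.metric.val (Φ.symm x).1 (mfderiv 𝓘(ℝ, E4) (𝓡 4) Φ.symm x v)
          (mfderiv 𝓘(ℝ, E4) (𝓡 4) Φ.symm x w) :=
      DFunLike.congr_fun (DFunLike.congr_fun (hΦ (Φ.symm x))
        (mfderiv 𝓘(ℝ, E4) (𝓡 4) Φ.symm x v)) (mfderiv 𝓘(ℝ, E4) (𝓡 4) Φ.symm x w)
    rw [hAD v, hAD w] at key
    show 𝓑.metric.val (ι x) (mfderiv (𝓡 4) (𝓡 4) ι x v) (mfderiv (𝓡 4) (𝓡 4) ι x w) =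
      Minkowski.bilin v w
    rw [hD]
    exact key.symm
  have hext : LorentzianManifold.IsExtendible ∞ Minkowski.spacetime.toLorentzianManifold :=
    ⟨𝓑.toLorentzianManifold, ι, h1, h2, h3, h4⟩
  exact minkowski_isC0Inextendible_holds (LorentzianManifold.isExtendible_mono bot_le hext)

end StationaryAFBlackHole

/-! ### Vishveshwara's identity for hypersurface-orthogonal Killing fields -/

namespace PseudoRiemannianMetric

variable {E : Type*} [NormedAddCommGroup E] [NormedSpace ℝ E] {H : Type*} [TopologicalSpace H]
  {I : ModelWithCorners ℝ E H} {M : Type*} [TopologicalSpace M] [ChartedSpace H M]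
  [IsManifold I ∞ M] {n : ℕ∞ω}
  {g : PseudoRiemannianMetric I n E (TangentSpace I : M → Type _)} [g.HasLeviCivita]

/-- **Killing antisymmetry**: for a Killing field `X`, `g(∇_Y X, Z) = -g(∇_Z X, Y)` (the Killing
equation `g(∇_Y X, Z) + g(Y, ∇_Z X) = 0` and symmetry of `g`). O'Neill 1983, Ch. 9, Prop. 9.25. [cite: ONeillSemiRiemannian1983, Ch. 9, Prop. 9.25] -/
theorem IsKillingField.val_leviCivita_antisymm {X : Π x : M, TangentSpace I x}
    (hX : g.IsKillingField X) (x : M) (Y Z : TangentSpace I x) :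
    g.val x (g.leviCivita X x Y) Z = -g.val x (g.leviCivita X x Z) Y := by
  have h := hX.2 x Y Z
  have hs : g.val x Y (g.leviCivita X x Z) = g.val x (g.leviCivita X x Z) Y := g.symm x _ _
  linarith

/-- **The twist form of a Killing field**: `(X♭ ∧ dX♭)(u, v, w) = 2 (X♭(u) g(∇_v X, w) +
X♭(v) g(∇_w X, u) + X♭(w) g(∇_u X, v))`, i.e. `6 X_{[a} ∇_b X_{c]}` (for a Killing field
`dX♭ = 2 ∇X♭`). Wald 1984, §7.1, (7.1.1). [cite: Wald1984, §7.1 (7.1.1)] -/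
theorem IsKillingField.twistForm_eq {X : Π x : M, TangentSpace I x} (hX : g.IsKillingField X)
    (x : M) (u v w : TangentSpace I x) :
    g.twistForm X x u v w =
      2 * (g.val x (X x) u * g.val x (g.leviCivita X x v) w +
        g.val x (X x) v * g.val x (g.leviCivita X x w) u +
        g.val x (X x) w * g.val x (g.leviCivita X x u) v) := by
  simp only [twistForm]
  rw [hX.val_leviCivita_antisymm x w v, hX.val_leviCivita_antisymm x u w,
    hX.val_leviCivita_antisymm x v u]
  ring

/-- **Vishveshwara's identity** (algebraic core of the Vishveshwara–Carter lemma): if the Killing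
field `X` is hypersurface-orthogonal on `A` (`X♭ ∧ dX♭ = 0` there), then at every `x ∈ A`, for all
`u, v`, `X♭(u) g(∇_v X, X) − X♭(v) g(∇_u X, X) + g(X, X) g(∇_u X, v) = 0` — the contraction of
`X_{[a} ∇_b X_{c]} = 0` with `X^c`. Since `g(∇_v X, X) = ½ v(g(X, X))`, on the set
`{g(X, X) = 0}` this says `X♭ ∧ d(g(X, X)) = 0`: the null set of a static Killing vector is ruled
by hypersurfaces to which `X` is normal (Killing prehorizons). Chruściel–Costa–Heusler 2012, §2.5
(Vishveshwara [CVV68]: "`ω = 0` and `i_k dk ≠ 0` on `𝒩` ⟹ Killing horizon"; the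
Vishveshwara–Carter lemma); Wald 1984, §7.1. [cite: ChruscielCostaHeusler2012, §2.5 (Vishveshwara–Carter lemma)] -/
theorem IsHypersurfaceOrthogonalOn.killing_contract {X : Π x : M, TangentSpace I x} {A : Set M}
    (h : g.IsHypersurfaceOrthogonalOn X A) (hX : g.IsKillingField X) {x : M} (hx : x ∈ A)
    (u v : TangentSpace I x) :
    g.val x (X x) u * g.val x (g.leviCivita X x v) (X x) -
        g.val x (X x) v * g.val x (g.leviCivita X x u) (X x) +
      g.val x (X x) (X x) * g.val x (g.leviCivita X x u) v = 0 := by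
  have h0 := h x hx u v (X x)
  rw [hX.twistForm_eq] at h0
  have h1 := hX.val_leviCivita_antisymm x (X x) u
  linear_combination (1 / 2 : ℝ) * h0 - g.val x (X x) v * h1

/-- **On the null set of a hypersurface-orthogonal Killing field, `X♭ ∧ (∇X♭ · X) = 0`**: if
moreover `g(X, X) = 0` at `x ∈ A`, then `X♭(u) g(∇_v X, X) = X♭(v) g(∇_u X, X)` for all `u, v` —
the one-form `v ↦ g(∇_v X, X) = ½ d(g(X,X))(v)` is proportional to `X♭` wherever `X♭ ≠ 0`, so the
gradient of `g(X, X)` is normal to `X^⊥ ∋ X`: the level set is null with `X` tangent AND normal.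
Chruściel–Costa–Heusler 2012, §2.5 (Vishveshwara–Carter). [cite: ChruscielCostaHeusler2012, §2.5] -/
theorem IsHypersurfaceOrthogonalOn.killing_wedge_eq_of_null {X : Π x : M, TangentSpace I x}
    {A : Set M} (h : g.IsHypersurfaceOrthogonalOn X A) (hX : g.IsKillingField X) {x : M}
    (hx : x ∈ A) (hnull : g.val x (X x) (X x) = 0) (u v : TangentSpace I x) :
    g.val x (X x) u * g.val x (g.leviCivita X x v) (X x) =
      g.val x (X x) v * g.val x (g.leviCivita X x u) (X x) := by
  have h0 := h.killing_contract hX hx u v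
  rw [hnull, zero_mul, add_zero] at h0
  linarith

/-- In particular, on the null set, for `u ⊥ X` (`X♭(u) = 0`) and any `v` with `X♭(v) ≠ 0`:
`g(∇_u X, X) = 0`, i.e. `g(X, X)` is stationary in the directions of `X^⊥` — the null set is
(where `X♭ ≠ 0`) a level set whose tangent hyperplane is `X^⊥`. Chruściel–Costa–Heusler 2012,
§2.5. [cite: ChruscielCostaHeusler2012, §2.5] -/
theorem IsHypersurfaceOrthogonalOn.val_leviCivita_self_eq_zero_of_null
    {X : Π x : M, TangentSpace I x} {A : Set M} (h : g.IsHypersurfaceOrthogonalOn X A)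
    (hX : g.IsKillingField X) {x : M} (hx : x ∈ A) (hnull : g.val x (X x) (X x) = 0)
    {u v : TangentSpace I x} (hu : g.val x (X x) u = 0) (hv : g.val x (X x) v ≠ 0) :
    g.val x (g.leviCivita X x u) (X x) = 0 := by
  have h0 := h.killing_wedge_eq_of_null hX hx hnull u v
  rw [hu, zero_mul] at h0
  exact (mul_eq_zero.mp h0.symm).resolve_left hv

end PseudoRiemannianMetric

namespace StationaryAFBlackHole

variable {𝓑 : StationaryAFBlackHole.{u}}

/-- **Vishveshwara's identity for a static black hole**: the stationary Killing field `X` of a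
static `𝓑` satisfies `X♭(u) g(∇_v X, X) − X♭(v) g(∇_u X, X) + g(X, X) g(∇_u X, v) = 0` at every
point (first step of the exclusion of null orbits of `X` in the d.o.c., Chruściel–Costa–Heusler
2012, §3.1 and §2.5). [cite: ChruscielCostaHeusler2012, §3.1 and §2.5] -/
theorem IsStatic.killing_contract [𝓑.metric.HasLeviCivita] (h : 𝓑.IsStatic) (x : 𝓑.carrier)
    (u v : TangentSpace (𝓡 4) x) :
    𝓑.metric.val x (𝓑.killing x) u *
          𝓑.metric.val x (𝓑.metric.toPseudoRiemannianMetric.leviCivita 𝓑.killing x v)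
            (𝓑.killing x) -
        𝓑.metric.val x (𝓑.killing x) v *
          𝓑.metric.val x (𝓑.metric.toPseudoRiemannianMetric.leviCivita 𝓑.killing x u)
            (𝓑.killing x) +
      𝓑.metric.val x (𝓑.killing x) (𝓑.killing x) *
        𝓑.metric.val x (𝓑.metric.toPseudoRiemannianMetric.leviCivita 𝓑.killing x u) v = 0 :=
  PseudoRiemannianMetric.IsHypersurfaceOrthogonalOn.killing_contract h
    𝓑.isStationaryKilling.isKillingField (Set.mem_univ x) u v

end StationaryAFBlackHole

/-! ### Pointwise surface gravity on the null set of a static Killing vector -/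

namespace PseudoRiemannianMetric

variable {E : Type*} [NormedAddCommGroup E] [NormedSpace ℝ E] {H : Type*} [TopologicalSpace H]
  {I : ModelWithCorners ℝ E H} {M : Type*} [TopologicalSpace M] [ChartedSpace H M]
  [IsManifold I ∞ M] {n : ℕ∞ω}
  {g : PseudoRiemannianMetric I n E (TangentSpace I : M → Type _)}

/-- A non-zero vector pairs non-trivially with some vector (nondegeneracy of `g_x`). [folklore] -/
theorem exists_val_ne_zero_of_ne_zero (x : M) {v : TangentSpace I x} (hv : v ≠ 0) :
    ∃ w : TangentSpace I x, g.val x v w ≠ 0 := by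
  by_contra h
  exact hv (g.nondegenerate x v (by simpa using h))

variable [g.HasLeviCivita]

/-- For a Killing field, `g(∇_X X, w) = -g(∇_w X, X)`: the acceleration of `X` is minus the
`g`-dual of `½ d(g(X, X))`. O'Neill 1983, Ch. 9, Prop. 9.25; Wald 1984, §12.5, (12.5.2) ff. [cite: Wald1984, §12.5 (12.5.2)] -/
theorem IsKillingField.val_leviCivita_self_left {X : Π x : M, TangentSpace I x}
    (hX : g.IsKillingField X) (x : M) (w : TangentSpace I x) :
    g.val x (g.leviCivita X x (X x)) w = -g.val x (g.leviCivita X x w) (X x) :=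
  hX.val_leviCivita_antisymm x (X x) w

/-- **A hypersurface-orthogonal Killing field is pre-geodesic on its null set (pointwise surface
gravity).** If `X` is a Killing field with `X♭ ∧ dX♭ = 0` on `A`, then at every `x ∈ A` where
`g(X, X) = 0` and `X ≠ 0` there is `κ ∈ ℝ` with `∇_X X = κ X`. Indeed by Vishveshwara's identity
the one-form `w ↦ g(∇_w X, X)` is proportional to `X♭` there (`killing_wedge_eq_of_null`; `X♭ ≠ 0`
by nondegeneracy), and `g(∇_X X, w) = -g(∇_w X, X)` for a Killing field, so `g(∇_X X − κ X, ·) = 0`.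
This is the relation `∇_k k = κ k` defining the surface gravity on a Killing (pre)horizon
(Chruściel–Costa–Heusler 2012, §2.5.3, "an immediate consequence of the definition of a Killing
horizon or prehorizon is the proportionality of `k` and `DN` on `H[k]`"; Wald 1984, §12.5,
(12.5.2); the tree's `LorentzianMetric.IsNonDegenerateHorizon` asks for it with `κ ≠ 0`), here
obtained pointwise on the whole null set of a *static* Killing vector without knowing that this
set is a hypersurface. [cite: ChruscielCostaHeusler2012, §2.5.3 (surface gravity, ∇_k k = κ k)] -/
theorem IsHypersurfaceOrthogonalOn.exists_leviCivita_self_eq_smul_of_null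
    {X : Π x : M, TangentSpace I x} {A : Set M} (h : g.IsHypersurfaceOrthogonalOn X A)
    (hX : g.IsKillingField X) {x : M} (hx : x ∈ A) (hnull : g.val x (X x) (X x) = 0)
    (hne : X x ≠ 0) :
    ∃ κ : ℝ, g.leviCivita X x (X x) = κ • X x := by
  obtain ⟨v₀, hv₀⟩ := g.exists_val_ne_zero_of_ne_zero x hne
  refine ⟨-(g.val x (g.leviCivita X x v₀) (X x)) / g.val x (X x) v₀, ?_⟩
  -- it suffices to test against every `w`, by nondegeneracy
  have key : ∀ w : TangentSpace I x,
      g.val x (g.leviCivita X x (X x) -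
        (-(g.val x (g.leviCivita X x v₀) (X x)) / g.val x (X x) v₀) • X x) w = 0 := by
    intro w
    have h1 := h.killing_wedge_eq_of_null hX hx hnull w v₀
    -- `h1 : X♭(w) g(∇_{v₀} X, X) = X♭(v₀) g(∇_w X, X)`
    have h2 := hX.val_leviCivita_self_left x w
    have e : g.val x (g.leviCivita X x (X x) -
          (-(g.val x (g.leviCivita X x v₀) (X x)) / g.val x (X x) v₀) • X x) w =
        g.val x (g.leviCivita X x (X x)) w -
          (-(g.val x (g.leviCivita X x v₀) (X x)) / g.val x (X x) v₀) * g.val x (X x) w := by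
      rw [map_sub, map_smul]
      rfl
    rw [e, h2]
    field_simp
    linear_combination h1
  have hzero := g.nondegenerate x _ key
  exact sub_eq_zero.mp hzero

end PseudoRiemannianMetric

namespace StationaryAFBlackHole

variable {𝓑 : StationaryAFBlackHole.{u}}

/-- **The static Killing field of a static black hole is pre-geodesic wherever it is null and
non-zero**: `∇_X X = κ(x) X` at every such point `x` (pointwise surface gravity; on the event
horizon of Schwarzschild `κ = 1/4M`). Chruściel–Costa–Heusler 2012, §2.5.3; Wald 1984, §12.5,
(12.5.2). [cite: ChruscielCostaHeusler2012, §2.5.3] -/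
theorem IsStatic.exists_leviCivita_killing_self_eq_smul [𝓑.metric.HasLeviCivita]
    (h : 𝓑.IsStatic) {x : 𝓑.carrier}
    (hnull : 𝓑.metric.val x (𝓑.killing x) (𝓑.killing x) = 0) (hne : 𝓑.killing x ≠ 0) :
    ∃ κ : ℝ, 𝓑.metric.toPseudoRiemannianMetric.leviCivita 𝓑.killing x (𝓑.killing x) =
      κ • 𝓑.killing x :=
  PseudoRiemannianMetric.IsHypersurfaceOrthogonalOn.exists_leviCivita_self_eq_smul_of_null h
    𝓑.isStationaryKilling.isKillingField (Set.mem_univ x) hnull hne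

end StationaryAFBlackHole

/-! ### The orthogonal distribution of a static Killing vector is totally geodesic -/

namespace PseudoRiemannianMetric

variable {E : Type*} [NormedAddCommGroup E] [NormedSpace ℝ E] {H : Type*} [TopologicalSpace H]
  {I : ModelWithCorners ℝ E H} {M : Type*} [TopologicalSpace M] [ChartedSpace H M]
  [IsManifold I ∞ M] {n : ℕ∞ω}
  {g : PseudoRiemannianMetric I n E (TangentSpace I : M → Type _)} [g.HasLeviCivita]

/-- **The orthogonal distribution of a hypersurface-orthogonal Killing field is totally geodesic
(pointwise form).** If `X` is a Killing field with `X♭ ∧ dX♭ = 0` on `A`, then at every `x ∈ A`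
with `X ≠ 0`, `g(∇_u X, w) = 0` for all `u, w ∈ X^⊥`: evaluating
`(X♭ ∧ dX♭)(u, w, v) = 2 (X♭(u) g(∇_w X, v) + X♭(w) g(∇_v X, u) + X♭(v) g(∇_u X, w))`
(`IsKillingField.twistForm_eq`) on `u, w ⊥ X` leaves `2 X♭(v) g(∇_u X, w) = 0`, and some `v` has
`X♭(v) ≠ 0` by nondegeneracy. Where `X` is timelike this says that the hypersurfaces orthogonal to
a static Killing vector (the static slices) are totally geodesic — `II(u, w) = -g(∇_u X, w)/g(X, X)
= 0`, time-symmetric data `K = 0`; where `X` is null (so `X ∈ X^⊥`) it is the "totally geodesic"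
clause of the Vishveshwara–Carter lemma for the prehorizon leaves. Chruściel–Costa–Heusler 2012,
§2.5.2 ("the set `{g(k, k) = 0, k ≠ 0}` is the union of integral leaves of the distribution `k^⊥`,
which are totally geodesic within `M ∖ {k = 0}`"); Wald 1984, App. B.3 (Frobenius) and §7.1. [cite: ChruscielCostaHeusler2012, §2.5.2 (Vishveshwara–Carter lemma, totally geodesic leaves)] -/
theorem IsHypersurfaceOrthogonalOn.val_leviCivita_eq_zero_of_orthogonal
    {X : Π x : M, TangentSpace I x} {A : Set M} (h : g.IsHypersurfaceOrthogonalOn X A)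
    (hX : g.IsKillingField X) {x : M} (hx : x ∈ A) (hne : X x ≠ 0) {u w : TangentSpace I x}
    (hu : g.val x (X x) u = 0) (hw : g.val x (X x) w = 0) :
    g.val x (g.leviCivita X x u) w = 0 := by
  obtain ⟨v, hv⟩ := g.exists_val_ne_zero_of_ne_zero x hne
  have h0 := h x hx u w v
  rw [hX.twistForm_eq, hu, hw] at h0
  have h1 : g.val x (X x) v * g.val x (g.leviCivita X x u) w = 0 := by linarith
  exact (mul_eq_zero.mp h1).resolve_left hv

/-- In particular, on the null set (`g(X, X) = 0`, `X ≠ 0`) of a hypersurface-orthogonal Killing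
field, `g(∇_X X, w) = 0` for every `w ⊥ X` (take `u = X ∈ X^⊥`): the acceleration `∇_X X` is
`g`-orthogonal to `X^⊥`, i.e. proportional to `X` (compare
`exists_leviCivita_self_eq_smul_of_null`). Chruściel–Costa–Heusler 2012, §2.5.2–2.5.3. [cite: ChruscielCostaHeusler2012, §2.5.2–2.5.3] -/
theorem IsHypersurfaceOrthogonalOn.val_leviCivita_self_eq_zero_of_null_of_orthogonal
    {X : Π x : M, TangentSpace I x} {A : Set M} (h : g.IsHypersurfaceOrthogonalOn X A)
    (hX : g.IsKillingField X) {x : M} (hx : x ∈ A) (hnull : g.val x (X x) (X x) = 0)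
    (hne : X x ≠ 0) {w : TangentSpace I x} (hw : g.val x (X x) w = 0) :
    g.val x (g.leviCivita X x (X x)) w = 0 :=
  h.val_leviCivita_eq_zero_of_orthogonal hX hx hne hnull hw

end PseudoRiemannianMetric

namespace StationaryAFBlackHole

variable {𝓑 : StationaryAFBlackHole.{u}}

/-- **The hypersurfaces orthogonal to the static Killing field of a static black hole are totally
geodesic** (pointwise form): wherever `X ≠ 0`, `g(∇_u X, w) = 0` for all `u, w ⊥ X` — in the
d.o.c., where `X` is timelike (Chruściel–Galloway 2010), the static slices are totally geodesic
(time-symmetric, `K = 0`, the starting point of the Riemannian reformulation `(S, γ, V)` of the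
static vacuum equations in Bunting–Masood-ul-Alam's argument); on the null set, the prehorizon
leaves are. Chruściel–Costa–Heusler 2012, §2.5.2 and §3.1. [cite: ChruscielCostaHeusler2012, §2.5.2 and §3.1] -/
theorem IsStatic.val_leviCivita_killing_eq_zero_of_orthogonal [𝓑.metric.HasLeviCivita]
    (h : 𝓑.IsStatic) {x : 𝓑.carrier} (hne : 𝓑.killing x ≠ 0) {u w : TangentSpace (𝓡 4) x}
    (hu : 𝓑.metric.val x (𝓑.killing x) u = 0) (hw : 𝓑.metric.val x (𝓑.killing x) w = 0) :
    𝓑.metric.val x (𝓑.metric.toPseudoRiemannianMetric.leviCivita 𝓑.killing x u) w = 0 :=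
  PseudoRiemannianMetric.IsHypersurfaceOrthogonalOn.val_leviCivita_eq_zero_of_orthogonal h
    𝓑.isStationaryKilling.isKillingField (Set.mem_univ x) hne hu hw

end StationaryAFBlackHole

/-! ### The domain of outer communications is connected -/

section Connected

/-- The exterior `{r < ‖x‖}` (`0 ≤ r`) of a closed ball in `ℝ³` is path-connected: it is the
image of `(r, ∞) × S²` under `(t, u) ↦ t u`, and `S²` is path-connected. [folklore] -/
theorem E3.isPathConnected_normGt {r : ℝ} (hr : 0 ≤ r) : IsPathConnected {x : E3 | r < ‖x‖} := by
  have hrank : 1 < Module.rank ℝ E3 := by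
    rw [← Module.finrank_eq_rank, finrank_euclideanSpace_fin]
    norm_num
  have hs : IsPathConnected (Metric.sphere (0 : E3) 1) := isPathConnected_sphere hrank 0 zero_le_one
  have hIoi : IsPathConnected (Set.Ioi r) := (convex_Ioi r).isPathConnected ⟨r + 1, by simp⟩
  have hprod : IsPathConnected (Set.Ioi r ×ˢ Metric.sphere (0 : E3) 1) := hIoi.prod hs
  have hcont : Continuous fun p : ℝ × E3 ↦ p.1 • p.2 := continuous_fst.smul continuous_snd
  have himg := hprod.image (f := fun p : ℝ × E3 ↦ p.1 • p.2) hcont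
  have heq : (fun p : ℝ × E3 ↦ p.1 • p.2) '' (Set.Ioi r ×ˢ Metric.sphere (0 : E3) 1) =
      {x : E3 | r < ‖x‖} := by
    ext x
    simp only [Set.mem_image, Set.mem_prod, Set.mem_Ioi, mem_sphere_iff_norm, sub_zero,
      Set.mem_setOf_eq, Prod.exists]
    constructor
    · rintro ⟨t, u, ⟨ht, hu⟩, rfl⟩
      rw [norm_smul, hu, mul_one, Real.norm_of_nonneg (hr.trans ht.le)]
      exact ht
    · intro hx
      have hx0 : 0 < ‖x‖ := hr.trans_lt hx
      refine ⟨‖x‖, ‖x‖⁻¹ • x, ⟨hx, ?_⟩, ?_⟩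
      · rw [norm_smul, norm_inv, norm_norm, inv_mul_cancel₀ hx0.ne']
      · rw [smul_smul, mul_inv_cancel₀ hx0.ne', one_smul]
  rw [← heq]
  exact himg

variable {Y : Type u} [TopologicalSpace Y] [ChartedSpace E3 Y]

/-- **Far regions of an asymptotically flat end are preconnected** (universe-polymorphic form of
`AFEnd.isPreconnected_far`, `Literature.Geometry.Lorentzian.ExteriorRegionSchwarzschildEnd`): for
`R ≤ R'`, `far R'` is the image under the inverse chart of the connected exterior `{R' < ‖x‖}` of a
ball in `ℝ³`. Bartnik 1986, §1. [cite: Bartnik1986, §1] -/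
theorem AFEnd.isPreconnected_far' (e : AFEnd Y) {R' : ℝ} (hR' : e.R ≤ R') :
    IsPreconnected (e.far R') := by
  -- the subset `S = {z : exteriorRegion R | R' < ‖z‖}` of the chart target is preconnected
  set S : Set (exteriorRegion e.R) := {z | R' < ‖(z : E3)‖} with hS
  have hSimg : Subtype.val '' S = {x : E3 | R' < ‖x‖} := by
    ext x
    constructor
    · rintro ⟨z, hz, rfl⟩
      exact hz
    · intro hx
      exact ⟨⟨x, (mem_exteriorRegion).2 (hR'.trans_lt hx)⟩, hx, rfl⟩
  have hSconn : IsPreconnected S := by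
    have h' : IsPreconnected (Subtype.val '' S) := by
      rw [hSimg]
      exact (E3.isPathConnected_normGt (e.R_pos.le.trans hR')).isConnected.isPreconnected
    exact (Topology.IsInducing.subtypeVal.isPreconnected_image).mp h'
  -- `far R'` is its image under the (continuous) inverse chart followed by the inclusion
  have hfar : e.far R' = (fun z ↦ ((e.chart.symm z : e.U) : Y)) '' S := by
    ext q
    constructor
    · rintro ⟨y, hy, rfl⟩
      refine ⟨e.chart y, hy, ?_⟩
      show ((e.chart.symm (e.chart y) : e.U) : Y) = y
      rw [e.chart.symm_apply_apply]
    · rintro ⟨z, hz, rfl⟩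
      refine ⟨e.chart.symm z, ?_, rfl⟩
      show R' < ‖((e.chart (e.chart.symm z) : exteriorRegion e.R) : E3)‖
      rw [e.chart.apply_symm_apply]
      exact hz
  rw [hfar]
  exact hSconn.image _ (continuous_subtype_val.comp e.chart.symm.continuous).continuousOn

end Connected

namespace StationaryAFBlackHole

variable (𝓑 : StationaryAFBlackHole.{u})

/-- Every far region of the end is non-empty (private copy of
`AFEnd.far_nonempty`/`StationaryAFBlackHole.image_far_nonempty` of the sibling files, universe
polymorphic). [folklore] -/
private theorem far_nonempty_aux (R' : ℝ) : (𝓑.e.far R').Nonempty := by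
  set t : ℝ := max R' 𝓑.e.R + 1 with ht
  have htR : 𝓑.e.R < t := by
    have := le_max_right R' 𝓑.e.R
    linarith
  have htR' : R' < t := by
    have := le_max_left R' 𝓑.e.R
    linarith
  have ht0 : 0 < t := 𝓑.e.R_pos.trans htR
  set z : E3 := t • EuclideanSpace.single (0 : Fin 3) (1 : ℝ) with hz
  have hzn : ‖z‖ = t := by
    rw [hz, norm_smul, Real.norm_of_nonneg ht0.le]
    simp
  have hzmem : z ∈ exteriorRegion 𝓑.e.R := by
    rw [mem_exteriorRegion, hzn]
    exact htR
  refine ⟨((𝓑.e.chart.symm ⟨z, hzmem⟩ : 𝓑.e.U) : 𝓑.X), 𝓑.e.chart.symm ⟨z, hzmem⟩, ?_, rfl⟩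
  show R' < ‖((𝓑.e.chart (𝓑.e.chart.symm ⟨z, hzmem⟩) : exteriorRegion 𝓑.e.R) : E3)‖
  rw [𝓑.e.chart.apply_symm_apply]
  show R' < ‖z‖
  rw [hzn]
  exact htR'

/-- The Killing orbits through the far region are future timelike curves (private copy of
`StationaryAFBlackHole.isFutureTimelikeCurveOn_of_isMIntegralCurve` of
`StationaryBlackHoleUniquenessProofs`). [folklore] -/
private theorem isFutureTimelikeCurveOn_orbit_aux [𝓑.metric.HasLeviCivita]
    {γ : ℝ → 𝓑.carrier} (hγ : IsMIntegralCurve γ 𝓑.killing)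
    (h0 : γ 0 ∈ 𝓑.embed '' 𝓑.e.far (𝓑.e.R + 1)) (s : Set ℝ) :
    𝓑.metric.IsFutureTimelikeCurveOn 𝓑.timeOrientation γ s := fun t _ ↦
  LorentzianMetric.futureTimelikeAt_of_hasMFDerivAt rfl (hγ t)
    (𝓑.isStationaryKilling.isTimelike (⟨γ, hγ, h0, t, rfl⟩ : γ t ∈ 𝓑.Mext)).1
    (𝓑.isStationaryKilling.isTimelike (⟨γ, hγ, h0, t, rfl⟩ : γ t ∈ 𝓑.Mext)).2

/-- `M_ext ⊆ ⟨⟨M_ext⟩⟩` (private copy of `StationaryAFBlackHole.Mext_subset_doc` of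
`StationaryBlackHoleUniquenessProofs`: `φ_t(p)` lies on the future timelike orbit from
`φ_{t-1}(p)` to `φ_{t+1}(p)`, both in `M_ext`). [folklore] -/
private theorem Mext_subset_doc_aux [𝓑.metric.HasLeviCivita] : 𝓑.Mext ⊆ 𝓑.doc := by
  rintro p ⟨γ, hγ, h0, t, rfl⟩
  refine ⟨⟨γ (t - 1), ⟨γ, hγ, h0, t - 1, rfl⟩, γ, t - 1, t, by linarith,
    𝓑.isFutureTimelikeCurveOn_orbit_aux hγ h0 _, rfl, rfl⟩, ?_⟩
  have h : γ (t + 1) ∈ 𝓑.metric.chronologicalFuture 𝓑.timeOrientation {γ t} :=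
    ⟨γ t, rfl, γ, t, t + 1, by linarith, 𝓑.isFutureTimelikeCurveOn_orbit_aux hγ h0 _, rfl, rfl⟩
  exact LorentzianMetric.chronologicalFuture_mono (g := 𝓑.metric)
    (τ := 𝓑.timeOrientation.reverse)
    (singleton_subset_iff.mpr (show γ (t + 1) ∈ 𝓑.Mext from ⟨γ, hγ, h0, t + 1, rfl⟩))
    (LorentzianMetric.mem_chronologicalPast_of_mem_chronologicalFuture h)

/-- The embedded far region `embed(Σ_ext')` is preconnected (continuous image of the exterior of
a ball). Chruściel–Costa 2008, §2.1. [cite: ChruscielCosta2008, §2.1] -/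
theorem isPreconnected_image_far : IsPreconnected (𝓑.embed '' 𝓑.e.far (𝓑.e.R + 1)) :=
  (𝓑.e.isPreconnected_far' (by linarith)).image _
    𝓑.isSmoothEmbedding.isEmbedding.continuous.continuousOn

/-- **The asymptotic region `M_ext = ⋃ₜ φₜ(Σ_ext')` is connected**: it is the union of the
(connected) Killing orbits through the (connected, non-empty) embedded far region.
Chruściel–Costa 2008, (2.1). [cite: ChruscielCosta2008, (2.1)] -/
theorem isConnected_Mext [𝓑.metric.HasLeviCivita] : IsConnected 𝓑.Mext := by
  obtain ⟨y₀, hy₀⟩ := 𝓑.far_nonempty_aux (𝓑.e.R + 1)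
  have hx₀ : 𝓑.embed y₀ ∈ 𝓑.embed '' 𝓑.e.far (𝓑.e.R + 1) := ⟨y₀, hy₀, rfl⟩
  refine ⟨⟨𝓑.embed y₀, 𝓑.image_far_subset_Mext hx₀⟩, ?_⟩
  -- `M_ext` is the union of the connected sets `A ∪ range γ`, `γ` an orbit through `A`
  set A : Set 𝓑.carrier := 𝓑.embed '' 𝓑.e.far (𝓑.e.R + 1) with hA
  let c : Set (Set 𝓑.carrier) :=
    {D | ∃ γ : ℝ → 𝓑.carrier, IsMIntegralCurve γ 𝓑.killing ∧ γ 0 ∈ A ∧ D = A ∪ Set.range γ}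
  have hunion : 𝓑.Mext = ⋃₀ c := by
    ext p
    constructor
    · rintro ⟨γ, hγ, h0, t, rfl⟩
      exact Set.mem_sUnion.2 ⟨A ∪ Set.range γ, ⟨γ, hγ, h0, rfl⟩, Or.inr ⟨t, rfl⟩⟩
    · intro hp
      obtain ⟨D, ⟨γ, hγ, h0, rfl⟩, hpD⟩ := Set.mem_sUnion.1 hp
      rcases hpD with hpA | ⟨t, rfl⟩
      · exact 𝓑.image_far_subset_Mext hpA
      · exact ⟨γ, hγ, h0, t, rfl⟩
  rw [hunion]
  refine isPreconnected_sUnion (𝓑.embed y₀) c (fun D ⟨γ, hγ, h0, hD⟩ ↦ hD ▸ Or.inl hx₀)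
    (fun D ⟨γ, hγ, h0, hD⟩ ↦ ?_)
  rw [hD]
  have hγc : Continuous γ := continuous_iff_continuousAt.2 fun t ↦ (hγ t).continuousAt
  refine (𝓑.isPreconnected_image_far).union (γ 0) h0 ⟨0, rfl⟩ ?_
  exact (isPreconnected_range hγc)

/-- Points of a future timelike curve segment lie in the causal diamond of its endpoints.
O'Neill 1983, Ch. 14, p. 402. [cite: ONeillSemiRiemannian1983, Ch. 14, p. 402] -/
theorem _root_.Literature.Geometry.Lorentzian.LorentzianMetric.IsFutureTimelikeCurveOn.mem_causalDiamond
    {E : Type*} [NormedAddCommGroup E] [NormedSpace ℝ E] {H : Type*} [TopologicalSpace H]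
    {I : ModelWithCorners ℝ E H} {n : ℕ∞ω} {M : Type*} [TopologicalSpace M] [ChartedSpace H M]
    [IsManifold I ∞ M] {g : LorentzianMetric I n M} {τ : TimeOrientation g} {γ : ℝ → M}
    {a b : ℝ}
    (hγ : g.IsFutureTimelikeCurveOn τ γ (Set.Icc a b)) {s : ℝ} (hs : s ∈ Set.Icc a b) :
    γ s ∈ g.causalFuture τ {γ a} ∩ g.causalPast τ {γ b} := by
  refine ⟨?_, ?_⟩
  · rcases eq_or_lt_of_le hs.1 with h | h
    · subst h
      exact LorentzianMetric.subset_causalFuture g τ _ rfl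
    · exact LorentzianMetric.chronologicalFuture_subset_causalFuture g τ _
        ⟨γ a, rfl, γ, a, s, h, hγ.mono (Set.Icc_subset_Icc_right hs.2), rfl, rfl⟩
  · rcases eq_or_lt_of_le hs.2 with h | h
    · subst h
      exact LorentzianMetric.subset_causalPast g τ _ rfl
    · have h1 : γ b ∈ g.chronologicalFuture τ {γ s} :=
        ⟨γ s, rfl, γ, s, b, h, hγ.mono (Set.Icc_subset_Icc_left hs.1), rfl, rfl⟩
      exact LorentzianMetric.chronologicalFuture_subset_causalFuture g τ.reverse _
        (LorentzianMetric.mem_chronologicalPast_of_mem_chronologicalFuture h1)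

/-- **A causally convex hull of a preconnected set is preconnected: the d.o.c. `⟨⟨M_ext⟩⟩` of a
preconnected `M_ext ⊆ ⟨⟨M_ext⟩⟩` is preconnected** (manifold without boundary, `1 ≤ n`). Every
`p ∈ ⟨⟨M_ext⟩⟩` is the endpoint of a future timelike segment from some `m ∈ M_ext`, all of whose
points lie in `J⁺(m) ∩ J⁻(p) ⊆ ⟨⟨M_ext⟩⟩` (`causalFuture_inter_causalPast_subset_docOfEnd`); so
`⟨⟨M_ext⟩⟩` is the union of the preconnected sets `M_ext ∪ segment`, all containing `M_ext`.
Chruściel–Costa–Heusler 2012, §2.4; O'Neill 1983, Ch. 14. [cite: ChruscielCostaHeusler2012, §2.4] -/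
theorem _root_.Literature.Geometry.Lorentzian.LorentzianMetric.isPreconnected_docOfEnd
    {E : Type*} [NormedAddCommGroup E] [NormedSpace ℝ E] {H : Type*} [TopologicalSpace H]
    {I : ModelWithCorners ℝ E H} {n : ℕ∞ω} {M : Type*} [TopologicalSpace M] [ChartedSpace H M]
    [IsManifold I ∞ M] [FiniteDimensional ℝ E] [BoundarylessManifold I M]
    {g : LorentzianMetric I n M} {τ : TimeOrientation g} (hn : 1 ≤ n) {Mext : Set M}
    (hMext : Mext ⊆ g.docOfEnd τ Mext) (hconn : IsPreconnected Mext) :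
    IsPreconnected (g.docOfEnd τ Mext) := by
  rcases Mext.eq_empty_or_nonempty with hempty | ⟨x₀, hx₀⟩
  · have : g.docOfEnd τ Mext = ∅ := by
      ext p
      simp only [Set.mem_empty_iff_false, iff_false]
      rintro ⟨⟨m, hm, -⟩, -⟩
      rw [hempty] at hm
      exact hm
    rw [this]
    exact isPreconnected_empty
  -- `doc` is the union over `p ∈ doc` of `M_ext ∪ (a timelike segment from M_ext to p)`
  let c : Set (Set M) :=
    {D | ∃ (p : M) (γ : ℝ → M) (a b : ℝ), p ∈ g.docOfEnd τ Mext ∧ a < b ∧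
      g.IsFutureTimelikeCurveOn τ γ (Set.Icc a b) ∧ γ a ∈ Mext ∧ γ b = p ∧
      D = Mext ∪ γ '' Set.Icc a b}
  have hsub : ∀ D ∈ c, D ⊆ g.docOfEnd τ Mext := by
    rintro D ⟨p, γ, a, b, hp, hab, hγ, hγa, hγb, rfl⟩
    refine Set.union_subset hMext ?_
    rintro _ ⟨s, hs, rfl⟩
    have h := LorentzianMetric.IsFutureTimelikeCurveOn.mem_causalDiamond hγ hs
    rw [hγb] at h
    exact LorentzianMetric.causalFuture_inter_causalPast_subset_docOfEnd hn (hMext hγa) hp h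
  have hunion : g.docOfEnd τ Mext = ⋃₀ c := by
    refine Set.Subset.antisymm (fun p hp ↦ ?_) (Set.sUnion_subset hsub)
    obtain ⟨m, hm, γ, a, b, hab, hγ, hγa, hγb⟩ := hp.1
    refine Set.mem_sUnion.2 ⟨Mext ∪ γ '' Set.Icc a b,
      ⟨p, γ, a, b, hp, hab, hγ, hγa ▸ hm, hγb, rfl⟩, Or.inr ⟨b, ⟨hab.le, le_rfl⟩, hγb⟩⟩
  rw [hunion]
  refine isPreconnected_sUnion x₀ c (fun D ⟨p, γ, a, b, _, _, _, _, _, hD⟩ ↦ hD ▸ Or.inl hx₀)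
    (fun D ⟨p, γ, a, b, hp, hab, hγ, hγa, hγb, hD⟩ ↦ ?_)
  rw [hD]
  have hcont : ContinuousOn γ (Set.Icc a b) := fun s hs ↦
    (hγ.isFutureCausalCurveOn.continuousAt hs).continuousWithinAt
  exact hconn.union (γ a) hγa ⟨a, ⟨le_rfl, hab.le⟩, rfl⟩ ((isPreconnected_Icc).image γ hcont)

/-- **The domain of outer communications of a stationary asymptotically flat black hole is
connected** (`M_ext` is connected and `M_ext ⊆ ⟨⟨M_ext⟩⟩`, `isPreconnected_docOfEnd`), hence — being
open — a connected open sub-space-time, the object compared with the Schwarzschild/Kerr d.o.c. in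
the conclusions `IsIsometricToSchwarzschildExterior`/`IsIsometricToKerrExterior`.
Chruściel–Costa–Heusler 2012, §2.4; Chruściel–Costa 2008, §2.2. [cite: ChruscielCostaHeusler2012, §2.4] -/
theorem isConnected_doc [𝓑.metric.HasLeviCivita] : IsConnected 𝓑.doc := by
  have hMext := 𝓑.isConnected_Mext
  obtain ⟨x₀, hx₀⟩ := hMext.nonempty
  exact ⟨⟨x₀, 𝓑.Mext_subset_doc_aux hx₀⟩,
    LorentzianMetric.isPreconnected_docOfEnd (g := 𝓑.metric) (τ := 𝓑.timeOrientation)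
      ENat.LEInfty.out 𝓑.Mext_subset_doc_aux hMext.isPreconnected⟩

/-- The domain of outer communications is a connected space (as an open submanifold).
Chruściel–Costa–Heusler 2012, §2.4. [cite: ChruscielCostaHeusler2012, §2.4] -/
theorem connectedSpace_docOpens [𝓑.metric.HasLeviCivita]
    (hF : 𝓑.metric.isOpen_chronologicalFuture 𝓑.timeOrientation)
    (hP : 𝓑.metric.isOpen_chronologicalPast 𝓑.timeOrientation) :
    ConnectedSpace (𝓑.docOpens hF hP) :=
  isConnected_iff_connectedSpace.mp 𝓑.isConnected_doc

end StationaryAFBlackHole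

/-! ### Static slices are totally geodesic -/

namespace PseudoRiemannianMetric

variable {E : Type*} [NormedAddCommGroup E] [NormedSpace ℝ E] {H : Type*} [TopologicalSpace H]
  {I : ModelWithCorners ℝ E H} {M : Type*} [TopologicalSpace M] [ChartedSpace H M]
  [IsManifold I ∞ M] {n : ℕ∞ω}
  {E' : Type*} [NormedAddCommGroup E'] [NormedSpace ℝ E'] {H' : Type*} [TopologicalSpace H']
  {I' : ModelWithCorners ℝ E' H'} {N : Type*} [TopologicalSpace N] [ChartedSpace H' N]
  [IsManifold I' ∞ N]
  [FiniteDimensional ℝ E] [Fact (1 ≤ n)] [FiniteDimensional ℝ E']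
  {g : PseudoRiemannianMetric I n E (TangentSpace I : M → Type _)} [g.HasLeviCivita]

/-- The regularity exponent of a metric admitting the Levi-Civita API is non-zero (`1 ≤ n`).
[folklore] -/
private lemma n_ne_zero' : n ≠ 0 := by
  intro h
  have h1 : (1 : ℕ∞ω) ≤ n := Fact.out
  rw [h] at h1
  exact absurd h1 (by decide)

omit [Fact (1 ≤ n)] [FiniteDimensional ℝ E'] in
/-- **`D_w (X ∘ f) = ∇_{df w} X`**: the covariant derivative along `f : N → M`, in the direction
`w ∈ T_y N` at an interior point `y`, of the restriction of a vector field `X` of `M`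
differentiable at `f y` (private form of
`Literature.Geometry.Riemannian.normalDerivAlong_comp_eq_leviCivita`, O'Neill 1983, Ch. 3,
Prop. 3.18 (3) and Ch. 4, Lemma 4.1). [cite: ONeill1983, Ch. 3, Prop. 3.18 (3)] -/
private theorem normalDerivAlong_restrict_eq {f : N → M} {X : Π x : M, TangentSpace I x} {y : N}
    (hy : I'.IsInteriorPoint y) (hf : MDifferentiableAt I' I f y)
    (hX : MDifferentiableAt I I.tangent (fun x ↦ (TotalSpace.mk' E x (X x) : TangentBundle I M))
      (f y))
    (w : TangentSpace I' y) :
    g.normalDerivAlong f (fun x ↦ X (f x)) y w = g.leviCivita X (f y) (mfderiv I' I f y w) := by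
  have hc := mdifferentiableAt_curveThrough_zero hy w
  have hf' : MDifferentiableAt I' I f (curveThrough I' y w 0) := by
    rw [curveThrough_zero]; exact hf
  have hX' : MDifferentiableAt I I.tangent
      (fun x ↦ (TotalSpace.mk' E x (X x) : TangentBundle I M)) ((f ∘ curveThrough I' y w) 0) := by
    rw [Function.comp_apply, curveThrough_zero]; exact hX
  have h := covariantDerivAlong_comp_holds g.leviCivita (γ := f ∘ curveThrough I' y w) (Y := X)
    (t₀ := 0) (hf'.comp 0 hc) hX'
  have hv : velocity I (f ∘ curveThrough I' y w) 0 =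
      mfderiv I' I f (curveThrough I' y w 0) (velocity I' (curveThrough I' y w) 0) := by
    simp only [velocity]
    rw [mfderiv_comp 0 hf' hc]
    rfl
  rw [hv] at h
  simp only [Function.comp_apply] at h
  rw [curveThrough_zero, velocity_curveThrough_zero_holds hy w] at h
  exact h

/-- **A hypersurface everywhere orthogonal to a hypersurface-orthogonal Killing field is totally
geodesic** (with respect to the normal field `X ∘ f`): if `X` is a Killing field with
`X♭ ∧ dX♭ = 0` on `A ⊇ f(N)`, non-vanishing along `f`, and `df_y(T_y N) ⊆ X(f y)^⊥` for all `y`,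
then the second fundamental form of `f` with respect to `ν = X ∘ f` vanishes identically:
`K_ν(v, w) = g(D_v ν, df w) = g(∇_{df v} X, df w) = 0` by
`IsHypersurfaceOrthogonalOn.val_leviCivita_eq_zero_of_orthogonal`. For a static space-time this is
the classical statement that the hypersurfaces orthogonal to the static Killing vector — the
static slices `{t = const}` of `g = -V² dt² + γ` — are totally geodesic, i.e. carry
**time-symmetric** data `K = 0` (with respect to the unit normal `X/V` as well, `K_{X/V} = V⁻¹ K_X`
on `X^⊥`), the starting point of the Riemannian reformulation `(S, γ, V)`, `Δ_γ V = 0`,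
`Ric(γ) = V⁻¹ ∇² V`, of the static vacuum equations used by Israel and Bunting–Masood-ul-Alam.
Chruściel–Costa–Heusler 2012, §2.5.2 (Vishveshwara–Carter: leaves of `k^⊥` totally geodesic) and
§3.1; Wald 1984, §6.1 (static space-times) and (10.2.13); O'Neill 1983, Ch. 4, Def. 4.12,
Ch. 12 (static space-times). [cite: ChruscielCostaHeusler2012, §2.5.2 and §3.1] -/
theorem IsHypersurfaceOrthogonalOn.isTotallyGeodesic_of_orthogonal
    {X : Π x : M, TangentSpace I x} {A : Set M} (h : g.IsHypersurfaceOrthogonalOn X A)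
    (hX : g.IsKillingField X) {f : N → M} (hf : ∀ y, MDifferentiableAt I' I f y)
    (hint : ∀ y : N, I'.IsInteriorPoint y) (hfA : ∀ y, f y ∈ A) (hne : ∀ y, X (f y) ≠ 0)
    (horth : ∀ (y : N) (w : TangentSpace I' y), g.val (f y) (X (f y)) (mfderiv I' I f y w) = 0) :
    g.IsTotallyGeodesic I' f (fun y ↦ X (f y)) := by
  intro y
  have hXd : MDifferentiableAt I I.tangent
      (fun x ↦ (TotalSpace.mk' E x (X x) : TangentBundle I M)) (f y) :=
    (hX.contMDiff (f y)).mdifferentiableAt n_ne_zero'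
  have hν : MDifferentiableAt I' I.tangent
      (fun x ↦ (TotalSpace.mk' E (f x) (X (f x)) : TangentBundle I M)) y :=
    hXd.comp y (hf y)
  ext v w
  rw [secondFundamentalForm_apply_holds (hint y) hν v w,
    normalDerivAlong_restrict_eq (hint y) (hf y) hXd v]
  exact h.val_leviCivita_eq_zero_of_orthogonal hX (hfA y) (hne y) (horth y v) (horth y w)

end PseudoRiemannianMetric

namespace StationaryAFBlackHole

variable {𝓑 : StationaryAFBlackHole.{u}}

/-- **The slice of a static black hole is time-symmetric wherever it is orthogonal to the static
Killing field.** If the embedded slice `S = embed(X)` of a static `𝓑` is everywhere orthogonal to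
the (nowhere vanishing on `S`) static Killing field — as for the canonical static slicing — then it
is totally geodesic: its second fundamental form with respect to the normal field
`X ∘ embed` vanishes (`PseudoRiemannianMetric.IsTotallyGeodesic`), so the induced data are
time-symmetric (`K = 0`; the structure's `k = D.k` is taken with respect to the unit normal
`X/V`, for which `K_{X/V} = V⁻¹ K_X = 0` on `TS`). Chruściel–Costa–Heusler 2012, §3.1 (static
d.o.c. and the Riemannian problem `(S, γ, V)`); Wald 1984, §6.1. [cite: ChruscielCostaHeusler2012, §3.1] -/
theorem IsStatic.isTotallyGeodesic_embed_of_orthogonal [𝓑.metric.HasLeviCivita] (h : 𝓑.IsStatic)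
    (hne : ∀ y : 𝓑.X, 𝓑.killing (𝓑.embed y) ≠ 0)
    (horth : ∀ (y : 𝓑.X) (w : TangentSpace (𝓡 3) y),
      𝓑.metric.val (𝓑.embed y) (𝓑.killing (𝓑.embed y)) (mfderiv (𝓡 3) (𝓡 4) 𝓑.embed y w) = 0) :
    𝓑.metric.toPseudoRiemannianMetric.IsTotallyGeodesic (𝓡 3) 𝓑.embed
      (fun y ↦ 𝓑.killing (𝓑.embed y)) :=
  PseudoRiemannianMetric.IsHypersurfaceOrthogonalOn.isTotallyGeodesic_of_orthogonal h
    𝓑.isStationaryKilling.isKillingField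
    (fun y ↦ (𝓑.isSmoothEmbedding.contMDiff y).mdifferentiableAt (by simp))
    (fun _ ↦ BoundarylessManifold.isInteriorPoint) (fun y ↦ Set.mem_univ _) hne horth

end StationaryAFBlackHole

/-! ### Time-symmetric data: `K = 0` for the unit normal of a slice orthogonal to `X` -/

namespace PseudoRiemannianMetric

variable {E : Type*} [NormedAddCommGroup E] [NormedSpace ℝ E] {H : Type*} [TopologicalSpace H]
  {I : ModelWithCorners ℝ E H} {M : Type*} [TopologicalSpace M] [ChartedSpace H M]
  [IsManifold I ∞ M] {n : ℕ∞ω}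
  {E' : Type*} [NormedAddCommGroup E'] [NormedSpace ℝ E'] {H' : Type*} [TopologicalSpace H']
  {I' : ModelWithCorners ℝ E' H'} {N : Type*} [TopologicalSpace N] [ChartedSpace H' N]
  [IsManifold I' ∞ N]
  [FiniteDimensional ℝ E] [Fact (1 ≤ n)] [FiniteDimensional ℝ E']
  {g : PseudoRiemannianMetric I n E (TangentSpace I : M → Type _)} [g.HasLeviCivita]

omit [Fact (1 ≤ n)] [FiniteDimensional ℝ E'] in
/-- **Rescaling the normal: `K_{a • (X ∘ f)}(v, w) = a K_{X∘f}(v, w)` on basis vectors, for a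
normal `X`.** For a vector field `X` of `M` differentiable at `f y`, normal to `f` at `y`
(`g(X(f y), df_y w) = 0` for all `w`), and a scalar function `a : N → ℝ` differentiable at the
interior point `y`, the field `ν = a • (X ∘ f)` along `f` has
`g(D_{bᵢ} ν, df w) = a(y) g(D_{bᵢ}(X ∘ f), df w)`: by the Leibniz rule along the chart-straight
curve (`covariantDerivAlong_smul_holds`) `D_{bᵢ} ν = (a ∘ c)'(0) X(f y) + a(y) D_{bᵢ}(X ∘ f)`, and
the first term is normal. O'Neill 1983, Ch. 3, Prop. 3.18 (2) and Ch. 4, Lemma 4.1. [cite: ONeillSemiRiemannian1983, Ch. 3, Prop. 3.18 (2)] -/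
theorem val_normalDerivAlong_smul_restrict {f : N → M} {X : Π x : M, TangentSpace I x}
    {a : N → ℝ} {y : N} (hy : I'.IsInteriorPoint y) (hf : MDifferentiableAt I' I f y)
    (hX : MDifferentiableAt I I.tangent (fun x ↦ (TotalSpace.mk' E x (X x) : TangentBundle I M))
      (f y))
    (ha : MDifferentiableAt I' 𝓘(ℝ, ℝ) a y)
    (horth : ∀ w : TangentSpace I' y, g.val (f y) (X (f y)) (mfderiv I' I f y w) = 0)
    (v w : TangentSpace I' y) :
    g.val (f y) (g.normalDerivAlong f (fun x ↦ a x • X (f x)) y v) (mfderiv I' I f y w) =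
      a y * g.val (f y) (g.normalDerivAlong f (fun x ↦ X (f x)) y v) (mfderiv I' I f y w) := by
  have hc := mdifferentiableAt_curveThrough_zero hy v
  have hc0 : curveThrough I' y v 0 = y := curveThrough_zero I' y v
  have hf' : MDifferentiableAt I' I f (curveThrough I' y v 0) := by
    rw [hc0]; exact hf
  have hγ : MDifferentiableAt 𝓘(ℝ, ℝ) I (f ∘ curveThrough I' y v) 0 := hf'.comp 0 hc
  -- differentiability of the scalar factor along the curve
  have ha' : MDifferentiableAt I' 𝓘(ℝ, ℝ) a (curveThrough I' y v 0) := by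
    rw [hc0]; exact ha
  have hac : DifferentiableAt ℝ (fun t ↦ a (curveThrough I' y v t)) 0 :=
    (ha'.comp 0 hc).differentiableAt
  -- differentiability of the lift of `X ∘ f ∘ c`
  have hX' : MDifferentiableAt I I.tangent
      (fun x ↦ (TotalSpace.mk' E x (X x) : TangentBundle I M)) ((f ∘ curveThrough I' y v) 0) := by
    rw [Function.comp_apply, hc0]; exact hX
  have hW : MDifferentiableAt 𝓘(ℝ, ℝ) I.tangent
      (fun t ↦ (TotalSpace.mk' E ((f ∘ curveThrough I' y v) t)
        (X ((f ∘ curveThrough I' y v) t)) : TangentBundle I M)) 0 :=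
    hX'.comp 0 hγ
  -- Leibniz along the curve
  have hL := covariantDerivAlong_smul_holds g.leviCivita (γ := f ∘ curveThrough I' y v)
    (W := fun t ↦ X ((f ∘ curveThrough I' y v) t)) (f := fun t ↦ a (curveThrough I' y v t))
    (t₀ := 0) hac hW
  -- the identity at the base point `(f ∘ c) 0`, where all the fibres agree syntactically
  have horth' : ∀ w' : TangentSpace I' y, g.val ((f ∘ curveThrough I' y v) 0)
      (X ((f ∘ curveThrough I' y v) 0)) (mfderiv I' I f (curveThrough I' y v 0) w') = 0 := by
    intro w'
    rw [Function.comp_apply, hc0]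
    exact horth w'
  have main : g.val ((f ∘ curveThrough I' y v) 0)
      (covariantDerivAlong g.leviCivita (f ∘ curveThrough I' y v)
        (fun t ↦ a (curveThrough I' y v t) • X ((f ∘ curveThrough I' y v) t)) 0)
      (mfderiv I' I f (curveThrough I' y v 0) w) =
      a (curveThrough I' y v 0) * g.val ((f ∘ curveThrough I' y v) 0)
        (covariantDerivAlong g.leviCivita (f ∘ curveThrough I' y v)
          (fun t ↦ X ((f ∘ curveThrough I' y v) t)) 0)
        (mfderiv I' I f (curveThrough I' y v 0) w) := by
    rw [hL, map_add, map_smul, map_smul, add_apply, smul_apply, smul_apply, smul_eq_mul,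
      smul_eq_mul, horth' w, mul_zero, zero_add]
  simp only [Function.comp_apply] at main
  rw [hc0] at main
  exact main

/-- **The unit normal of a slice orthogonal to a static Killing field has `K = 0`.** Let `X` be a
Killing field with `X♭ ∧ dX♭ = 0` on `A ⊇ f(N)`, and let `ν` be a field along `f` (meant: the unit
normal) with `X ∘ f = V • ν` for a nowhere-vanishing scalar `V : N → ℝ` (the lapse) differentiable
at every (interior) point, `ν` normal to `f`. Then `K_ν = 0` identically: `ν = V⁻¹ • (X ∘ f)`, so
`K_ν(bᵢ, w) = V(y)⁻¹ K_{X∘f}(bᵢ, w)` (`val_normalDerivAlong_smul_restrict`) and `K_{X∘f} = 0`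
(`IsHypersurfaceOrthogonalOn.isTotallyGeodesic_of_orthogonal`). This is the time-symmetry
`K_{ij} = 0` of the static slices with respect to their unit normal `n = X/V`. Wald 1984, §6.1 and
(10.2.13); Chruściel–Costa–Heusler 2012, §3.1. [cite: ChruscielCostaHeusler2012, §3.1 (static slices, time-symmetric data)] -/
theorem IsHypersurfaceOrthogonalOn.isTotallyGeodesic_of_killing_eq_smul
    {X : Π x : M, TangentSpace I x} {A : Set M} (h : g.IsHypersurfaceOrthogonalOn X A)
    (hX : g.IsKillingField X) {f : N → M} {ν : NormalField I f} {V : N → ℝ}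
    (hf : ∀ y, MDifferentiableAt I' I f y) (hint : ∀ y : N, I'.IsInteriorPoint y)
    (hfA : ∀ y, f y ∈ A) (hV : ∀ y, V y ≠ 0) (hVd : ∀ y, MDifferentiableAt I' 𝓘(ℝ, ℝ) V y)
    (hν0 : ∀ y, ν y ≠ 0) (hνorth : ∀ (y : N) (w : TangentSpace I' y),
      g.val (f y) (ν y) (mfderiv I' I f y w) = 0)
    (hprop : ∀ y, X (f y) = V y • ν y) :
    g.IsTotallyGeodesic I' f ν := by
  -- `X ∘ f` is normal and non-vanishing, so `K_{X∘f} = 0`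
  have horth : ∀ (y : N) (w : TangentSpace I' y),
      g.val (f y) (X (f y)) (mfderiv I' I f y w) = 0 := fun y w ↦ by
    rw [hprop y, map_smul, smul_apply, hνorth y w, smul_zero]
  have hne : ∀ y, X (f y) ≠ 0 := fun y ↦ by
    rw [hprop y]
    exact smul_ne_zero (hV y) (hν0 y)
  have hK := h.isTotallyGeodesic_of_orthogonal hX hf hint hfA hne horth
  -- `ν = V⁻¹ • (X ∘ f)`
  have hνeq : ν = fun y ↦ (V y)⁻¹ • X (f y) := by
    funext y
    rw [hprop y, smul_smul, inv_mul_cancel₀ (hV y), one_smul]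
  intro y
  haveI : FiniteDimensional ℝ (TangentSpace I' y) := inferInstanceAs (FiniteDimensional ℝ E')
  have hXd : MDifferentiableAt I I.tangent
      (fun x ↦ (TotalSpace.mk' E x (X x) : TangentBundle I M)) (f y) :=
    (hX.contMDiff (f y)).mdifferentiableAt n_ne_zero'
  have hVinv : MDifferentiableAt I' 𝓘(ℝ, ℝ) (fun x ↦ (V x)⁻¹) y := by
    have h1 : MDifferentiableAt 𝓘(ℝ, ℝ) 𝓘(ℝ, ℝ) (fun t : ℝ ↦ t⁻¹) (V y) :=
      (differentiableAt_inv (hV y)).mdifferentiableAt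
    exact h1.comp y (hVd y)
  -- vanishing on the canonical basis in the first slot
  refine (Module.finBasis ℝ (TangentSpace I' y)).ext fun i ↦ LinearMap.ext fun w ↦ ?_
  have h0 : g.val (f y) (g.normalDerivAlong f (fun x ↦ X (f x)) y
      (Module.finBasis ℝ (TangentSpace I' y) i)) (mfderiv I' I f y w) = 0 := by
    rw [← g.secondFundamentalForm_apply_basis f (fun x ↦ X (f x)) y i w, hK y]
    rfl
  rw [LinearMap.zero_apply, LinearMap.zero_apply, secondFundamentalForm_apply_basis, hνeq,
    val_normalDerivAlong_smul_restrict (hint y) (hf y) hXd hVinv (horth y) _ w, h0, mul_zero]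

end PseudoRiemannianMetric

namespace StationaryAFBlackHole

variable {𝓑 : StationaryAFBlackHole.{u}}

/-- **The slice of a static black hole is time-symmetric wherever the static Killing field is
proportional to its unit normal.** If along the embedded slice `S = embed(X)` the static Killing
field is `X ∘ embed = V • n` for the future unit normal `n = 𝓑.normal` and a nowhere-vanishing
differentiable lapse `V : X → ℝ` (the canonical static slicing, `X = V n`, `V² = -g(X, X)`), then
the second fundamental form of the slice with respect to `n` vanishes identically
(`IsHypersurfaceOrthogonalOn.isTotallyGeodesic_of_killing_eq_smul`), i.e. by `induced_k` the
data are **time-symmetric**, `k = 0` — the setting `(S, γ, V)`, `K_{ij} = 0`, of the static vacuum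
problem treated by Israel and Bunting–Masood-ul-Alam. Chruściel–Costa–Heusler 2012, §3.1; Wald 1984,
§6.1 and (10.2.13). [cite: ChruscielCostaHeusler2012, §3.1 (static slices carry time-symmetric data)] -/
theorem IsStatic.isTotallyGeodesic_embed_normal [𝓑.metric.HasLeviCivita] (h : 𝓑.IsStatic)
    {V : 𝓑.X → ℝ} (hV : ∀ y, V y ≠ 0) (hVd : ∀ y, MDifferentiableAt (𝓡 3) 𝓘(ℝ, ℝ) V y)
    (hprop : ∀ y, 𝓑.killing (𝓑.embed y) = V y • 𝓑.normal y) :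
    𝓑.metric.toPseudoRiemannianMetric.IsTotallyGeodesic (𝓡 3) 𝓑.embed 𝓑.normal := by
  have hν0 : ∀ y, 𝓑.normal y ≠ 0 := fun y h0 ↦ by
    have h1 := 𝓑.isFutureUnitNormal.1.val_self y
    rw [h0, map_zero] at h1
    norm_num at h1
  exact PseudoRiemannianMetric.IsHypersurfaceOrthogonalOn.isTotallyGeodesic_of_killing_eq_smul h
    𝓑.isStationaryKilling.isKillingField
    (fun y ↦ (𝓑.isSmoothEmbedding.contMDiff y).mdifferentiableAt (by simp))
    (fun _ ↦ BoundarylessManifold.isInteriorPoint) (fun y ↦ Set.mem_univ _) hV hVd hν0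
    (fun y w ↦ 𝓑.isFutureUnitNormal.1.isNormalTo y w) hprop

/-- **Time-symmetric data**: under the same hypotheses the second fundamental form `k = D.k` of
the initial data set carried by the slice vanishes, `k_y(v, w) = 0` for all `y, v, w`
(`induced_k`: `K_n = k`). Chruściel–Costa–Heusler 2012, §3.1; Wald 1984, (10.2.13). [cite: ChruscielCostaHeusler2012, §3.1] -/
theorem IsStatic.k_eq_zero_of_killing_eq_smul_normal [𝓑.metric.HasLeviCivita] (h : 𝓑.IsStatic)
    {V : 𝓑.X → ℝ} (hV : ∀ y, V y ≠ 0) (hVd : ∀ y, MDifferentiableAt (𝓡 3) 𝓘(ℝ, ℝ) V y)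
    (hprop : ∀ y, 𝓑.killing (𝓑.embed y) = V y • 𝓑.normal y) (y : 𝓑.X)
    (v w : TangentSpace (𝓡 3) y) : 𝓑.D.k y v w = 0 := by
  have hK := h.isTotallyGeodesic_embed_normal hV hVd hprop y
  rw [𝓑.induced_k y] at hK
  have := LinearMap.BilinForm.ext_iff.mp hK v w
  rwa [InitialDataSet.kBilin_apply, LinearMap.zero_apply, LinearMap.zero_apply] at this

end StationaryAFBlackHole

/-! ### The static slice is scalar-flat: time-symmetric vacuum data -/

namespace StationaryAFBlackHole

variable (𝓑 : StationaryAFBlackHole.{u})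

/-- **The embedded slice is a spacelike immersion**: `embed` is `C^∞` and the induced form
`embed^* g = h` is positive definite (`induced_h` and positivity of the Riemannian metric `h` of
the data). O'Neill 1983, Ch. 4, p. 97; Wald 1984, §10.2. [cite: ONeillSemiRiemannian1983, Ch. 4, p. 97] -/
theorem isSpacelikeImmersion_embed :
    𝓑.metric.toPseudoRiemannianMetric.IsSpacelikeImmersion (𝓡 3) 𝓑.embed := by
  refine ⟨𝓑.isSmoothEmbedding.contMDiff.of_le (le_of_eq rfl), fun y v hv ↦ ?_⟩
  have h := 𝓑.induced_h y
  have h' : 𝓑.metric.toPseudoRiemannianMetric.inducedBilin (𝓡 3) 𝓑.embed y v v =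
      𝓑.D.h.inner y v v := by
    show pullbackBilin (I := 𝓡 4) (I' := 𝓡 3) 𝓑.embed 𝓑.metric.val y v v = 𝓑.D.h.inner y v v
    rw [h]
  rw [h']
  exact 𝓑.D.h.pos y v hv

/-- The induced metric `embed^* g` of the slice has the same values as the data metric `h`
(`induced_h`). [folklore] -/
theorem inducedMetric_embed_val_eq (hfi : 𝓑.metric.toPseudoRiemannianMetric.IsSpacelikeImmersion (𝓡 3) 𝓑.embed)
    (y : 𝓑.X) :
    (𝓑.metric.toPseudoRiemannianMetric.inducedMetric 𝓑.embed
      PseudoRiemannianMetric.contMDiff_pullbackBilin_holds hfi).val y = 𝓑.D.metric.val y := by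
  rw [PseudoRiemannianMetric.inducedMetric_val, InitialDataSet.val_metric]
  exact 𝓑.induced_h y

variable {𝓑}

/-- **A static vacuum slice orthogonal to the Killing field is scalar-flat.** Let `𝓑` be static
and vacuum (`Ric(g) = 0`), with unit normal `n` of the embedded slice smooth as a map into `TM`
and the static Killing field proportional to it along the slice, `X ∘ embed = V • n` (`V` nowhere
zero, differentiable). Then the scalar curvature of the data metric `h = embed^* g` vanishes:
by the twice-traced Gauss equation (`scalarCurvature_inducedMetric_eq_general`, O'Neill 1983,
Ch. 4, Thm. 5 and Corollary, with `ε = g(n, n) = -1`)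
`R(h) = R(g) + 2 Ric(n, n) - (H² - |K|²)`, where `R(g) = Ric = 0` (vacuum) and `K = 0`
(`IsStatic.isTotallyGeodesic_embed_normal`, so `H = 0`, `|K|² = 0`). Together with `k = 0`
(`IsStatic.k_eq_zero_of_killing_eq_smul_normal`) this says that the static slice carries
**time-symmetric vacuum data `(S, h)` with `R(h) = 0`** — the Riemannian manifold to which the
positive energy theorem is applied in Bunting–Masood-ul-Alam's proof (after the conformal
rescalings `h± = ((1 ± V)/2)⁴ h`). Chruściel–Costa–Heusler 2012, §3.1; Wald 1984, (10.2.30) with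
`K_{ab} = 0`; Bartnik–Isenberg 2004, §2. [cite: ChruscielCostaHeusler2012, §3.1 (static vacuum data are time-symmetric and scalar-flat)] -/
theorem IsStatic.scalarCurvature_slice_eq_zero [𝓑.metric.HasLeviCivita] [𝓑.D.metric.HasLeviCivita]
    (h : 𝓑.IsStatic) (hvac : 𝓑.metric.toPseudoRiemannianMetric.IsRicciFlat)
    (hνs : ContMDiff (𝓡 3) (𝓡 4).tangent ∞
      (fun x ↦ (TotalSpace.mk' E4 (𝓑.embed x) (𝓑.normal x) : TangentBundle (𝓡 4) 𝓑.carrier)))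
    {V : 𝓑.X → ℝ} (hV : ∀ y, V y ≠ 0) (hVd : ∀ y, MDifferentiableAt (𝓡 3) 𝓘(ℝ, ℝ) V y)
    (hprop : ∀ y, 𝓑.killing (𝓑.embed y) = V y • 𝓑.normal y) (y : 𝓑.X) :
    𝓑.D.metric.scalarCurvature y = 0 := by
  set g := 𝓑.metric.toPseudoRiemannianMetric with hg
  have hfi : g.IsSpacelikeImmersion (𝓡 3) 𝓑.embed := 𝓑.isSpacelikeImmersion_embed
  have hun : g.IsUnitNormal (𝓡 3) 𝓑.embed 𝓑.normal (-1) := 𝓑.isFutureUnitNormal.1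
  haveI := (g.inducedMetric 𝓑.embed PseudoRiemannianMetric.contMDiff_pullbackBilin_holds
    hfi).hasLeviCivita
  have hm : Module.finrank ℝ E3 = 3 := finrank_euclideanSpace_fin
  have hm1 : Module.finrank ℝ E4 = 3 + 1 := finrank_euclideanSpace_fin
  have hG := PseudoRiemannianMetric.scalarCurvature_inducedMetric_eq_general g
    PseudoRiemannianMetric.contMDiff_pullbackBilin_holds hfi hνs hun (by norm_num) hm hm1 y
  -- vacuum: `Ric = 0`, `R(g) = 0`; static: `K = 0`, hence `H = 0`, `|K|² = 0`
  have hK : g.secondFundamentalForm (𝓡 3) 𝓑.embed 𝓑.normal y = 0 :=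
    h.isTotallyGeodesic_embed_normal hV hVd hprop y
  have hRic : g.ricci (𝓑.embed y) = 0 := hvac _
  have hS : g.scalarCurvature (𝓑.embed y) = 0 := by
    simp [PseudoRiemannianMetric.scalarCurvature, hRic, PseudoRiemannianMetric.trace]
  have hH : g.meanCurvature 𝓑.embed PseudoRiemannianMetric.contMDiff_pullbackBilin_holds hfi
      𝓑.normal y = 0 := by
    simp [PseudoRiemannianMetric.meanCurvature, hK, PseudoRiemannianMetric.trace]
  rw [hK, hH, hRic, hS, PseudoRiemannianMetric.normSq_zero] at hG
  simp only [LinearMap.zero_apply, mul_zero, zero_div, sub_zero, zero_pow two_ne_zero,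
    add_zero] at hG
  -- transfer from `embed^* g` to the data metric `h` (same values)
  rw [← PseudoRiemannianMetric.scalarCurvature_congr_of_val_eq
    (𝓑.inducedMetric_embed_val_eq hfi) y]
  exact hG

/-- **Time-symmetric vacuum data.** Under the hypotheses of `scalarCurvature_slice_eq_zero` the
initial data set `(h, k)` carried by the static slice is time-symmetric (`k = 0`) and solves the
vacuum constraint equations — which for time-symmetric data reduce to `R(h) = 0`
(`InitialDataSet.isVacuumConstraintSolution_iff_of_isTimeSymmetric`). Chruściel–Costa–Heusler
2012, §3.1; Bartnik–Isenberg 2004, §2; Choquet-Bruhat 2009, Ch. VII. [cite: ChruscielCostaHeusler2012, §3.1] -/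
theorem IsStatic.isTimeSymmetric_and_isVacuumConstraintSolution [𝓑.metric.HasLeviCivita]
    [𝓑.D.metric.HasLeviCivita]
    (h : 𝓑.IsStatic) (hvac : 𝓑.metric.toPseudoRiemannianMetric.IsRicciFlat)
    (hνs : ContMDiff (𝓡 3) (𝓡 4).tangent ∞
      (fun x ↦ (TotalSpace.mk' E4 (𝓑.embed x) (𝓑.normal x) : TangentBundle (𝓡 4) 𝓑.carrier)))
    {V : 𝓑.X → ℝ} (hV : ∀ y, V y ≠ 0) (hVd : ∀ y, MDifferentiableAt (𝓡 3) 𝓘(ℝ, ℝ) V y)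
    (hprop : ∀ y, 𝓑.killing (𝓑.embed y) = V y • 𝓑.normal y) :
    𝓑.D.IsTimeSymmetric ∧ 𝓑.D.IsVacuumConstraintSolution := by
  have hts : 𝓑.D.IsTimeSymmetric := fun y ↦ by
    ext v w
    exact h.k_eq_zero_of_killing_eq_smul_normal hV hVd hprop y v w
  exact ⟨hts, (InitialDataSet.isVacuumConstraintSolution_iff_of_isTimeSymmetric hts).mpr
    fun y ↦ h.scalarCurvature_slice_eq_zero hvac hνs hV hVd hprop y⟩

end StationaryAFBlackHole

/-! ### Bunting–Masood-ul-Alam: the conformally rescaled metrics `((1 ± V)/2)⁴ h` are scalar-flat -/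

namespace PseudoRiemannianMetric

variable {Y : Type*} [TopologicalSpace Y] [ChartedSpace E3 Y] [IsManifold (𝓡 3) ∞ Y]
  (γ γ' : PseudoRiemannianMetric (𝓡 3) ∞ E3 (TangentSpace (𝓡 3) : Y → Type _))
  [γ.HasLeviCivita] [γ'.HasLeviCivita]

/-- **The Laplacian of an affine function of `V`**: `Δ_γ ((1 + s V)/2) = (s/2) Δ_γ V` at a point
where `V` is `C²` (chain rule `dalembertian_real_comp` with `ζ(t) = (1 + s t)/2`, `ζ' = s/2`,
`ζ'' = 0`). [folklore] -/
theorem dalembertian_bmaFactor {V : Y → ℝ} (s : ℝ) {x : Y}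
    (hV : ContMDiffAt (𝓡 3) 𝓘(ℝ, ℝ) 2 V x) :
    γ.dalembertian (fun y ↦ (1 + s * V y) / 2) x = s / 2 * γ.dalembertian V x := by
  have hζ : ContDiffAt ℝ 2 (fun t : ℝ ↦ (1 + s * t) / 2) (V x) :=
    ((contDiff_const.add (contDiff_const.mul contDiff_id)).div_const 2).contDiffAt
  have hd : deriv (fun t : ℝ ↦ (1 + s * t) / 2) = fun _ ↦ s / 2 := by
    funext t
    have : HasDerivAt (fun t : ℝ ↦ (1 + s * t) / 2) (s / 2) t := by
      simpa using (((hasDerivAt_id t).const_mul s).const_add 1).div_const 2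
    exact this.deriv
  have hdd : deriv (deriv (fun t : ℝ ↦ (1 + s * t) / 2)) = fun _ ↦ 0 := by
    rw [hd]
    funext t
    exact deriv_const t (s / 2)
  have h := γ.dalembertian_real_comp (u := V) (ζ := fun t : ℝ ↦ (1 + s * t) / 2) hV hζ
  rw [hdd, hd] at h
  simp only [zero_mul, zero_add] at h
  exact h

/-- **Bunting–Masood-ul-Alam's conformal rescalings are scalar-flat.** Let `(Y, γ)` be a
Riemannian `3`-manifold with **vanishing scalar curvature** and `V` a smooth **`γ`-harmonic**
function (`Δ_γ V = 0`), and let `s ∈ ℝ` (meant: `s = ±1`) with `1 + s V > 0`. Then every smooth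
metric `γ'` with `γ' = ((1 + s V)/2)⁴ γ` pointwise has vanishing scalar curvature: by the
conformal transformation law in dimension three
(`scalarCurvature_conformal_fourth_power`: `R(φ⁴ γ) = φ⁻⁵ (R(γ) φ − 8 Δ_γ φ)`, Schoen–Yau 1979,
p. 49) with `φ = (1 + s V)/2`, `Δ_γ φ = (s/2) Δ_γ V = 0` (`dalembertian_bmaFactor`). For the
time-symmetric, scalar-flat data `(S, γ, V)` of a static vacuum black hole (`R(γ) = 0`,
`IsStatic.scalarCurvature_slice_eq_zero`; the lapse `V = √(−g(X, X))`, `0 < V < 1` on the d.o.c.,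
is `γ`-harmonic by the static vacuum equations) these are the two metrics
`γ± = ((1 ± V)/2)⁴ γ` which Bunting–Masood-ul-Alam glue along the horizon `{V = 0}` into a
complete, scalar-flat, asymptotically flat manifold of vanishing mass, to which the rigidity case
of the positive energy theorem is applied. Bunting–Masood-ul-Alam, Gen. Rel. Grav. 19 (1987) 147,
§2; Chruściel–Costa–Heusler 2012, §3.1 ("A breakthrough was made by Bunting and Masood-ul-Alam
[BMuA87UT], who showed how to use the positive energy theorem to exclude non-connected
configurations"); Heusler 1996, §9.3. [cite: ChruscielCostaHeusler2012, §3.1 (Bunting–Masood-ul-Alam conformal argument)] -/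
theorem scalarCurvature_bmaConformal_eq_zero (hγ : γ.IsRiemannian)
    (hR : ∀ x, γ.scalarCurvature x = 0) {V : Y → ℝ} (hV : ContMDiff (𝓡 3) 𝓘(ℝ, ℝ) ∞ V)
    (hΔ : ∀ x, γ.dalembertian V x = 0) (s : ℝ) (hpos : ∀ x, 0 < (1 + s * V x) / 2)
    (hγγ' : ∀ (x : Y) (v w : TangentSpace (𝓡 3) x),
      γ'.val x v w = ((1 + s * V x) / 2) ^ 4 * γ.val x v w) (x : Y) :
    γ'.scalarCurvature x = 0 := by
  have hφ : ContMDiff (𝓡 3) 𝓘(ℝ) ∞ (fun y ↦ (1 + s * V y) / 2) :=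
    (contMDiff_const.add (contMDiff_const.mul hV)).div_const 2
  rw [scalarCurvature_conformal_fourth_power γ γ' hγ hφ hpos hγγ' x, hR x,
    γ.dalembertian_bmaFactor s ((hV x).of_le (by exact WithTop.coe_le_coe.2 le_top)), hΔ x]
  ring

end PseudoRiemannianMetric

namespace StationaryAFBlackHole

variable {𝓑 : StationaryAFBlackHole.{u}}

/-- **The BMuA metrics of a static vacuum black hole are scalar-flat** (specialisation to the data
of the canonical static slice): under the hypotheses of `IsStatic.scalarCurvature_slice_eq_zero`
(static, vacuum, `X ∘ embed = V • n`, smooth unit normal) and given that the lapse `V` is smooth,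
`h`-harmonic (the lapse equation `Δ_h V = 0` of the static vacuum equations, not derived here)
and `1 ± V > 0`, every smooth metric `h'` on the slice with `h' = ((1 + s V)/2)⁴ h`
(`s = ±1`) has `R(h') = 0`. Bunting–Masood-ul-Alam 1987, §2; Chruściel–Costa–Heusler 2012, §3.1. [cite: ChruscielCostaHeusler2012, §3.1] -/
theorem IsStatic.scalarCurvature_bmaConformal_slice_eq_zero [𝓑.metric.HasLeviCivita]
    [𝓑.D.metric.HasLeviCivita]
    (h : 𝓑.IsStatic) (hvac : 𝓑.metric.toPseudoRiemannianMetric.IsRicciFlat)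
    (hνs : ContMDiff (𝓡 3) (𝓡 4).tangent ∞
      (fun x ↦ (TotalSpace.mk' E4 (𝓑.embed x) (𝓑.normal x) : TangentBundle (𝓡 4) 𝓑.carrier)))
    {V : 𝓑.X → ℝ} (hV : ∀ y, V y ≠ 0) (hVs : ContMDiff (𝓡 3) 𝓘(ℝ, ℝ) ∞ V)
    (hprop : ∀ y, 𝓑.killing (𝓑.embed y) = V y • 𝓑.normal y)
    (hΔ : ∀ y, 𝓑.D.metric.dalembertian V y = 0) (s : ℝ) (hpos : ∀ y, 0 < (1 + s * V y) / 2)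
    (h' : PseudoRiemannianMetric (𝓡 3) ∞ E3 (TangentSpace (𝓡 3) : 𝓑.X → Type _))
    [h'.HasLeviCivita]
    (hhh' : ∀ (y : 𝓑.X) (v w : TangentSpace (𝓡 3) y),
      h'.val y v w = ((1 + s * V y) / 2) ^ 4 * 𝓑.D.metric.val y v w) (y : 𝓑.X) :
    h'.scalarCurvature y = 0 :=
  PseudoRiemannianMetric.scalarCurvature_bmaConformal_eq_zero 𝓑.D.metric h'
    𝓑.D.isRiemannian_metric
    (fun x ↦ h.scalarCurvature_slice_eq_zero hvac hνs hV
      (fun z ↦ (hVs z).mdifferentiableAt (by simp)) hprop x)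
    hVs hΔ s hpos hhh' y

end StationaryAFBlackHole

end Literature.Geometry.Lorentzian

end
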